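import Literature.Geometry.Riemannian.HamiltonCurvatureRatio
import Literature.Geometry.Riemannian.ChangGurskyYangRegularity
import Literature.Geometry.Lorentzian.MetricNormSqBounds
import Literature.Geometry.Riemannian.RicciFlow
import Literature.Geometry.Riemannian.CurvatureNormSq
import Literature.Geometry.Riemannian.ChangGurskyYangProofs
import Literature.Geometry.Riemannian.RicciFlowScalarCurvature
import Mathlib.Analysis.SpecialFunctions.Pow.Continuity
import Mathlib.Analysis.SpecialFunctions.Pow.Asymptotics
import Literature.Geometry.Riemannian.RicciFlowSpatialRicciBounds
import Literature.Geometry.Riemannian.RicciFlowShortTimeProofs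
import Literature.Geometry.Riemannian.RicciFlowMaximal
import Literature.Geometry.Riemannian.LipschitzSmoothing
import Literature.Geometry.Riemannian.BonnetMyers
import Literature.Geometry.Riemannian.LiQingShiPinchingProofs
import Literature.Geometry.Riemannian.RicciFlowShiEstimates
import Literature.Geometry.Riemannian.ShiDerivativeMaxPrinciple
import Literature.Geometry.Riemannian.CurvatureDerivativeNormSq
import Literature.Geometry.Riemannian.HamiltonPinchedFlowGradientEstimates
import HarnessLib

/-!
# Hamilton's pinched Ricci flow in dimension four, II: `R_max/R_min → 1`, Type-I bounds, roundness rate, scaled Shi estimates (re-homed proofs)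

**Hamilton's convergence criterion (Hamilton 1986, §5, 5.2) in dimension four — file 2 of 4 of the EXACT discharge of
`Literature.Geometry.Riemannian.hamilton_convergenceCriterion_four`.**  Contents: Hamilton 1982, Thm. 15.1 with a localised Ricci
hypothesis (`Rc ≥ (R/m − |E|) g`, Myers' theorem [Myers1941]); frame algebra in dimension four (`W = 0` from `|W|² = 0`,
`|Rm|² = |W|² + 2|E|² + R²/6`, Besse 1987, 1.117–1.118 [Besse1987]); `R_max / R_min → 1` at the singular time of a pinched
maximal flow (Hamilton 1982, §15; Huisken 1985, §4 [Huisken1985]); oscillation decay of `R`; Type-I bounds and the roundness rate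
(Hamilton 1982, §16, §17 Lemma 17.2, Cor. 17.3, Cor. 17.5 [Hamilton1982]); scaled Shi estimates near the final time (Topping 2006,
§3.3 [Topping2006]).
RE-HOMED into `Literature/` by the Hodge foundations lane (`lit-hodgefound`, seat p20, generation 40): verbatim
DECLARATION-LEVEL ports (the declarations needed, in dependency order; each Part is one Summits module with a neutralised
module docstring) of the theorem-only cone below `Summits/SmoothPoincare4/SmoothPoincare4/Theorems/EntropyRungChangGurskyYangFlowLeafClosed.lean`
(33 modules `EntropyRungMargerinRailsDefs`, `EntropyRungChangGurskyYang{StubInitialFit,StubMaximalFlow,StubInvariantPinching,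
StubGradientEstimates*,StubRoundnessRate*,StubCurvatureRatio*,StubLimitRound,StubScaledShi,StubSmoothRoundLimit*,OfBlowupLimit,FlowLeafClosed}`;
139 declarations in four files `HamiltonPinchedFlowGradientEstimates` → `HamiltonPinchedFlowRoundnessRate` →
`HamiltonPinchedFlowCurvatureDecay` → `HamiltonConvergenceCriterionHolds`), namespace
`Summit.SmoothPoincare4.SmoothPoincare4.Theorems.MargerinRails` re-rooted as `Literature.Geometry.Riemannian.HamiltonPinchedFlow`
(the in-tree `stub_…`/`helper_…` theorem names are kept so that twins have the same short names; they are proved theorems).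
Built on the tree's Literature Ricci-flow layer (`Literature/Geometry/Riemannian/RicciFlow*`, `CurvatureNormSq`,
`CurvatureDerivativeNormSq`, `RicciFlowShiEstimates`, `ShiDerivativeMaxPrinciple`, `RicciFlowScalarMaximumPrinciple`,
`RicciFlowMaximal(Proofs)`, `RicciFlowShortTimeProofs`, `RicciFlowMetricLimit`, `RicciFlowSmoothExtension`, `HamiltonCurvatureODE`,
`HamiltonCurvatureRatio`, `PinchingEstimatesConstraints`, `ChangGurskyYang{Proofs,Regularity,WeylBudget}`, `BonnetMyers`, …) and
`Literature/Geometry/Lorentzian/` (coordinate curvature calculus).  Imports Mathlib/Literature only; no new named fact (D-0026);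
every declaration carries the citation of the printed statement it formalises or serves.  The Summits originals stay in place
(transitional duplication).  WHAT THIS IS NOT: nothing here bears on the smooth Poincaré conjecture in dimension four or on any
summit statement; it is Hamilton's 1982/1986 Ricci-flow analysis on a closed 4-manifold in the tree's vocabulary
(`PseudoRiemannianMetric`, `CovariantDerivative`, `IsRicciFlow` with explicit Levi-Civita witnesses).
-/

noncomputable section

/-!
## Part 1 — port of `Summits/SmoothPoincare4/SmoothPoincare4/Theorems/EntropyRungChangGurskyYangStubCurvatureRatioAux.lean` (4 declarations kept)

# Hamilton 1982, Thm. 15.1 with a localised Ricci hypothesis; `Rc ≥ (R/m − |E|) g`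

Declarations of this Part (verbatim port; each keeps its own docstring and citation): `one_sub_mul_le_of_ricci_ge_local`, `normSq_tracelessRicci_eq`, `sub_sqrt_mul_val_le_ricci`, `helper_curvatureRatio_localMyers`.

References: R. S. Hamilton, *Three-manifolds with positive Ricci curvature*, J. Differential Geom. 17 (1982) 255–306 [Hamilton1982]; S.-Y. A. Chang, M. J. Gursky, P. C. Yang, *A conformally invariant sphere theorem in four dimensions*, Publ. Math. IHÉS 98 (2003) 105–143 [ChangGurskyYang2003]; B. O'Neill, *Semi-Riemannian Geometry*, Academic Press 1983 [ONeill1983].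
-/

section Part1

open _root_.Set _root_.Function _root_.Filter _root_.Module
open scoped _root_.Manifold _root_.ContDiff _root_.Topology

namespace Literature.Geometry.Riemannian.HamiltonPinchedFlow

open Literature.Geometry.Riemannian
open Literature.Geometry.Lorentzian Literature.Geometry.Lorentzian.PseudoRiemannianMetric

/-! ## Hamilton 1982, Thm. 15.1, geometric step, with the Ricci hypothesis localised -/

section LocalRatio

variable {E : Type*} [NormedAddCommGroup E] [NormedSpace ℝ E] [FiniteDimensional ℝ E]
  [CompleteSpace E] {M : Type*} [TopologicalSpace M] [ChartedSpace E M] [IsManifold 𝓘(ℝ, E) ∞ M]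
  [T2Space M] [CompactSpace M] [ConnectedSpace M]
  (g : PseudoRiemannianMetric 𝓘(ℝ, E) ∞ E (TangentSpace 𝓘(ℝ, E) : M → Type _)) [g.HasLeviCivita]

/-- **Hamilton 1982, Thm. 15.1 (geometric step), Ricci hypothesis localised to `{R ≥ (1-η)R_max}`.**
On a compact connected boundaryless manifold of dimension `m ≥ 2` with a smooth Riemannian metric
`g`, let `R` be `C¹` with `R(x) > 0`, `|dR_y(w)| ≤ η² R(x)^{3/2} |w|_g`, and
`Rc_y(w, w) ≥ ε R(y) g_y(w, w)` AT THE POINTS `y` WITH `R(y) ≥ (1-η) R(x)`; if `0 < η < 1`, `ε > 0`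
and `π²(m-1)η² < ε(1-η)`, then `R ≥ (1-η) R(x)` everywhere. The printed proof (p. 299) verbatim —
it only invokes the Ricci bound along the initial segment of length `s = 1/(η√R(x))` of a unit-speed
geodesic from `x`, where `R ≥ R(x) − η² R(x)^{3/2} s = (1-η) R(x)` by the gradient bound
(`abs_sub_le_mul_of_mfderiv_le`); Hopf–Rinow (`exists_isMinimizingUpTo_of_isGeodesicallyComplete`)
and Myers (`length_mul_sqrt_le_pi_of_isMinimizingUpTo`, Hamilton's Thm. 15.2) as in the tree's
`one_sub_mul_le_of_ricci_ge_of_mfderiv_le`. [cite: Hamilton1982, §15, Thm. 15.1] -/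
theorem one_sub_mul_le_of_ricci_ge_local (hg : g.IsRiemannian)
    (hdim : 2 ≤ Module.finrank ℝ E) {R : M → ℝ} (hR : ∀ y, MDifferentiableAt 𝓘(ℝ, E) 𝓘(ℝ, ℝ) R y)
    {x : M} (hpos : 0 < R x) {η ε : ℝ} (hη : 0 < η) (hη1 : η < 1)
    (hε : 0 < ε)
    (hsmall : Real.pi ^ 2 * ((Module.finrank ℝ E : ℝ) - 1) * η ^ 2 < ε * (1 - η))
    (hgrad : ∀ (y : M) (w : TangentSpace 𝓘(ℝ, E) y),
      |(show ℝ from mfderiv 𝓘(ℝ, E) 𝓘(ℝ, ℝ) R y w)| ≤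
        η ^ 2 * (R x * Real.sqrt (R x)) * Real.sqrt (g.val y w w))
    (hRic : ∀ (y : M) (w : TangentSpace 𝓘(ℝ, E) y), (1 - η) * R x ≤ R y →
      ε * R y * g.val y w w ≤ g.leviCivita.ricci y w w)
    (y : M) : (1 - η) * R x ≤ R y := by
  -- adapted from Literature/Geometry/Riemannian/HamiltonCurvatureRatio.lean
  -- (`one_sub_mul_le_of_ricci_ge_of_mfderiv_le`), with `hRic` used only where `R ≥ (1-η) R x`
  have hLC := PseudoRiemannianMetric.isLeviCivita_leviCivita_holds (g := g)
  have hk1 : ((1 : ℕ∞) : ℕ∞ω) + 1 ≤ ∞ := by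
    rw [show ((1 : ℕ∞) : ℕ∞ω) + 1 = 2 by norm_num]
    exact WithTop.coe_le_coe.2 le_top
  haveI : CovariantDerivative.ContMDiffCovariantDerivative g.leviCivita 1 :=
    ⟨g.isLocallyContMDiff_leviCivita_holds 1 hk1 univ isOpen_univ⟩
  haveI : CovariantDerivative.ContMDiffCovariantDerivative g.leviCivita ∞ :=
    ⟨g.isLocallyContMDiff_leviCivita_holds ⊤ (le_of_eq rfl) univ isOpen_univ⟩
  have hc : IsGeodesicallyComplete g.leviCivita := hopfRinow_compact_geodesicallyComplete le_rfl hg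
  -- the constants
  set Rm := R x with hRm
  set m1 : ℝ := (Module.finrank ℝ E : ℝ) - 1 with hm1
  have hm1pos : 0 < m1 := by
    have : (2 : ℝ) ≤ (Module.finrank ℝ E : ℝ) := by exact_mod_cast hdim
    rw [hm1]; linarith
  have h1η : 0 < 1 - η := by linarith
  set sR := Real.sqrt Rm with hsR
  have hsR0 : 0 < sR := Real.sqrt_pos.2 hpos
  have hsq : sR ^ 2 = Rm := Real.sq_sqrt hpos.le
  set A := η ^ 2 * (Rm * sR) with hA
  have hA0 : 0 ≤ A := by positivity
  set s := 1 / (η * sR) with hs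
  have hs0 : 0 < s := by positivity
  have hAs : A * s = η * Rm := by
    rw [hA, hs]
    field_simp
  -- the estimate along unit-speed geodesics from `x`
  have hlow : ∀ (u : TangentSpace 𝓘(ℝ, E) x), g.val x u u = 1 → ∀ t, 0 ≤ t →
      Rm - A * t ≤ R (maximalGeodesic g.leviCivita x u t) := by
    intro u hu t ht
    have h := abs_sub_le_mul_of_mfderiv_le g hc hR hgrad x u hu ht
    rw [abs_le] at h
    linarith [h.1]
  -- a minimizing geodesic from `x` to `y`
  obtain ⟨v, hmin, hyv⟩ := exists_isMinimizingUpTo_of_isGeodesicallyComplete g le_rfl hg hc x y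
  have hvv0 : 0 ≤ g.val x v v := by
    by_cases hv : v = 0
    · simp [hv]
    · exact (hg x v hv).le
  set ℓ := Real.sqrt (g.val x v v) with hℓ
  rcases (show 0 ≤ ℓ from Real.sqrt_nonneg _).eq_or_lt with hℓ0 | hℓpos
  · -- `y = x`
    have hv0 : v = 0 := by
      by_contra hv
      have h1 : 0 < g.val x v v := hg x v hv
      have h2 : 0 < ℓ := Real.sqrt_pos.2 h1
      linarith
    have hyx : y = x := by
      rw [← hyv, hv0]
      exact riemannianExpMap_zero g x
    rw [hyx]
    nlinarith
  -- unit-speed reparametrisation `u = ℓ⁻¹ v`: minimizing up to `ℓ`, ending at `y`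
  have hvv : g.val x v v = ℓ ^ 2 := (Real.sq_sqrt hvv0).symm
  set u : TangentSpace 𝓘(ℝ, E) x := ℓ⁻¹ • v with hu'
  have hu : g.val x u u = 1 := by
    have h1 : g.val x u u = ℓ⁻¹ * ℓ⁻¹ * g.val x v v := by
      rw [hu']
      simp only [map_smul, FunLike.coe_smul, Pi.smul_apply, smul_eq_mul]
      ring
    rw [h1, hvv]
    field_simp
  have hminu : IsMinimizingUpTo g hg x u ℓ := by
    rw [hu', isMinimizingUpTo_smul_iff hg hc x v (inv_pos.2 hℓpos), inv_mul_cancel₀ hℓpos.ne']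
    exact hmin
  have hγℓ : maximalGeodesic g.leviCivita x u ℓ = y := by
    rw [hu', maximalGeodesic_smul hc x v ℓ⁻¹ ℓ, inv_mul_cancel₀ hℓpos.ne', ← hyv]
    exact (expMap_eq_maximalGeodesic hc x v).symm
  -- the speed of `γ_u`
  obtain ⟨-, hgeo, hγ0, hγu⟩ := maximalGeodesic_of_isGeodesicallyComplete hc x u
  have hspeed : ∀ t, g.val (maximalGeodesic g.leviCivita x u t)
      (velocity 𝓘(ℝ, E) (maximalGeodesic g.leviCivita x u) t)
      (velocity 𝓘(ℝ, E) (maximalGeodesic g.leviCivita x u) t) = 1 := by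
    intro t
    rw [g.val_velocity_eq_of_isGeodesicOn_of_isCompatible hLC.2 isOpen_univ Set.ordConnected_univ
      hgeo (mem_univ t) (mem_univ 0), hγu]
    have : maximalGeodesic g.leviCivita x u 0 = x := hγ0
    rw [this]
    exact hu
  -- the length is at most `s`, by Myers
  have hℓs : ℓ ≤ s := by
    by_contra hlt
    push Not at hlt
    have hmins : IsMinimizingUpTo g hg x u s := hminu.mono hc hs0.le hlt.le
    set k := ε * (1 - η) * Rm / m1 with hk
    have hk0 : 0 < k := by positivity
    have hRic' : ∀ t ∈ Ioo 0 s, ((Module.finrank ℝ E : ℝ) - 1) * k ≤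
        g.leviCivita.ricci (maximalGeodesic g.leviCivita x u t)
          (velocity 𝓘(ℝ, E) (maximalGeodesic g.leviCivita x u) t)
          (velocity 𝓘(ℝ, E) (maximalGeodesic g.leviCivita x u) t) := by
      intro t ht
      have h1 : (1 - η) * Rm ≤ R (maximalGeodesic g.leviCivita x u t) := by
        have h2 := hlow u hu t ht.1.le
        have h3 : A * t ≤ A * s := mul_le_mul_of_nonneg_left ht.2.le hA0
        rw [hAs] at h3
        linarith
      -- the localised Ricci bound applies at this point of the initial segment
      have h2 := hRic _ (velocity 𝓘(ℝ, E) (maximalGeodesic g.leviCivita x u) t) h1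
      rw [hspeed t, mul_one] at h2
      have h4 : m1 * k = ε * ((1 - η) * Rm) := by
        rw [hk]
        field_simp
      calc ((Module.finrank ℝ E : ℝ) - 1) * k = m1 * k := by rw [hm1]
        _ = ε * ((1 - η) * Rm) := h4
        _ ≤ ε * R (maximalGeodesic g.leviCivita x u t) := mul_le_mul_of_nonneg_left h1 hε.le
        _ ≤ _ := h2
    have hmy := length_mul_sqrt_le_pi_of_isMinimizingUpTo g hg hdim hc x u hu hk0 hs0 hmins hRic'
    -- but `s √k > π`
    have hsk : (s * Real.sqrt k) ^ 2 = ε * (1 - η) / (η ^ 2 * m1) := by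
      rw [mul_pow, Real.sq_sqrt hk0.le, hs, hk, div_pow, one_pow, mul_pow, hsq]
      field_simp
    have hπ : Real.pi ^ 2 < (s * Real.sqrt k) ^ 2 := by
      rw [hsk, lt_div_iff₀ (by positivity)]
      calc Real.pi ^ 2 * (η ^ 2 * m1) = Real.pi ^ 2 * m1 * η ^ 2 := by ring
        _ < ε * (1 - η) := hsmall
    have hcontra : Real.pi < s * Real.sqrt k := lt_of_pow_lt_pow_left₀ 2 (by positivity) hπ
    linarith
  -- conclusion along `γ_u|[0, ℓ]`
  have h1 := hlow u hu ℓ hℓpos.le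
  have h2 : A * ℓ ≤ A * s := mul_le_mul_of_nonneg_left hℓs hA0
  rw [hAs] at h2
  rw [← hγℓ]
  linarith

end LocalRatio

/-! ## `Rc ≥ (R/4 − |E|) g`: the traceless Ricci tensor against the metric square norm -/

section RicciLower

variable {E : Type*} [NormedAddCommGroup E] [NormedSpace ℝ E] {H : Type*} [TopologicalSpace H]
  {I : ModelWithCorners ℝ E H} {M : Type*} [TopologicalSpace M] [ChartedSpace H M]
  [IsManifold I ∞ M]
  (g : PseudoRiemannianMetric I ∞ E (TangentSpace I : M → Type _))
  [FiniteDimensional ℝ E] [g.HasLeviCivita]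

/-- **`|E|²_g(x)` is the metric square norm of the bilinear form `E = Ric − (S/m) g`**
(`normSq_eq_sum_sq` in an orthonormal basis versus the frame value
`tracelessRicciNormSq_eq_tracelessRicciNormSqFrame`, `tracelessRicciFrame_eq_tracelessRicci`), for a
Riemannian metric. [cite: ChangGurskyYang2003, (0.2)] -/
theorem normSq_tracelessRicci_eq (hg : g.IsRiemannian) (x : M) :
    g.normSq x (g.tracelessRicci x) = g.tracelessRicciNormSq x := by
  classical
  obtain ⟨b, hb⟩ := g.exists_basis_isOrthonormalFrame (x := x) (fun v hv ↦ hg x v hv) rfl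
  have hι : Fintype.card (Fin (finrank ℝ E)) = finrank ℝ E := Fintype.card_fin _
  have hO : (g.toBilinForm x).IsOrthoᵢ b := fun i j hij ↦ hb.2 i j hij
  have hc : ∀ i, g.val x (b i) (b i) ≠ 0 := fun i ↦ by
    rw [hb.1 i]
    exact one_ne_zero
  rw [g.normSq_eq_sum_sq x b hO hc, g.tracelessRicciNormSq_eq_tracelessRicciNormSqFrame hb,
    tracelessRicciNormSqFrame, Finset.sum_comm]
  simp only [hb.1, mul_one, div_one, g.tracelessRicciFrame_eq_tracelessRicci hb hι]

/-- **`Rc(w, w) ≥ (S/m − |E|) g(w, w)`** for a Riemannian metric (`m = dim`): `Rc = E + (S/m) g`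
and `|E(w, w)| ≤ √(|E|²) g(w, w)` by Cauchy–Schwarz for the metric square norm
(`abs_apply_le_sqrt_normSq_mul`, `normSq_tracelessRicci_eq`). [cite: Hamilton1982, §15, Thm. 15.1 (proof)] -/
theorem sub_sqrt_mul_val_le_ricci (hg : g.IsRiemannian) (x : M) (w : TangentSpace I x) :
    (g.scalarCurvature x / finrank ℝ E - Real.sqrt (g.tracelessRicciNormSq x)) * g.val x w w ≤
      g.ricci x w w := by
  have h := g.abs_apply_le_sqrt_normSq_mul x hg (g.tracelessRicci x) w
  rw [normSq_tracelessRicci_eq g hg, tracelessRicci_apply, abs_le] at h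
  rw [sub_mul]
  linarith [h.1]

end RicciLower

/-! ### Main statement -/

/-- **Hamilton 1982, Thm. 15.1 (geometric step, localised Ricci hypothesis) on a closed connected
4-manifold** — `one_sub_mul_le_of_ricci_ge_local` with `dim − 1 = 3` and the differential written as
`mvfderiv`: if `R` is `C¹`, `R(x) > 0`, `|dR_y(w)| ≤ η² R(x)^{3/2} |w|_g`, `Rc ≥ ε R g` at the points
with `R ≥ (1 − η) R(x)`, `0 < η < 1`, `0 < ε`, `3π²η² < ε(1 − η)`, then `R ≥ (1 − η) R(x)` everywhere.
[cite: Hamilton1982, §15, Thm. 15.1] -/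
theorem helper_curvatureRatio_localMyers : ∀ (M : Type) [TopologicalSpace M] [T2Space M] [ChartedSpace (EuclideanSpace ℝ (Fin 4)) M] [IsManifold (𝓡 4) ∞ M] [CompactSpace M] [ConnectedSpace M] (g : PseudoRiemannianMetric (𝓡 4) ∞ (EuclideanSpace ℝ (Fin 4)) (TangentSpace (𝓡 4) : M → Type _)) [g.HasLeviCivita], g.IsRiemannian → ∀ (R : M → ℝ) (x : M) (η ε : ℝ), (∀ y : M, MDifferentiableAt (𝓡 4) 𝓘(ℝ, ℝ) R y) → 0 < R x → 0 < η → η < 1 → 0 < ε → Real.pi ^ 2 * 3 * η ^ 2 < ε * (1 - η) → (∀ (y : M) (w : TangentSpace (𝓡 4) y), |mvfderiv (𝓡 4) R y w| ≤ η ^ 2 * (R x * Real.sqrt (R x)) * Real.sqrt (g.val y w w)) → (∀ (y : M) (w : TangentSpace (𝓡 4) y), (1 - η) * R x ≤ R y → ε * R y * g.val y w w ≤ g.ricci y w w) → ∀ y : M, (1 - η) * R x ≤ R y := by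
  intro M _ _ _ _ _ _ g _ hg R x η ε hR hpos hη hη1 hε hsmall hgrad hRic y
  have h4 : finrank ℝ (EuclideanSpace ℝ (Fin 4)) = 4 := finrank_euclideanSpace_fin
  refine one_sub_mul_le_of_ricci_ge_local g hg (by rw [h4]; norm_num) hR hpos hη hη1 hε ?_
    (fun y w ↦ hgrad y w) (fun y w h ↦ hRic y w h) y
  rw [h4]
  push_cast
  linarith

end Literature.Geometry.Riemannian.HamiltonPinchedFlow

end Part1

/-!
## Part 2 — port of `Summits/SmoothPoincare4/SmoothPoincare4/Theorems/EntropyRungChangGurskyYangStubLimitRound.lean` (3 declarations kept)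

# Frame algebra in dimension four: `finrank = 4`, `W = 0` from `|W|² = 0`, `|Rm|² = |W|² + 2|E|² + R²/6` (with a connection argument)

Declarations of this Part (verbatim port; each keeps its own docstring and citation): `finrank_euclideanFour`, `weylFrame_eq_zero_of_weylNormSq_eq_zero`, `curvNormSqWith_eq_weyl_add_traceless_add`.

References: R. S. Hamilton, *Four-manifolds with positive curvature operator*, J. Differential Geom. 24 (1986) 153–179 [Hamilton1986]; G. Huisken, *Ricci deformation of the metric on a Riemannian manifold*, J. Differential Geom. 21 (1985) 47–62 [Huisken1985]; C. Margerin, *A sharp characterization of the smooth 4-sphere in curvature terms*, Comm. Anal. Geom. 6 (1998) 21–65 [Margerin1998]; A. L. Besse, *Einstein Manifolds*, Springer 1987 [Besse1987].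
-/

section Part2

open _root_.Set _root_.Function _root_.Module _root_.Filter
open scoped _root_.Manifold _root_.ContDiff _root_.Topology

namespace Literature.Geometry.Riemannian.HamiltonPinchedFlow

open Literature.Geometry.Riemannian
open Literature.Geometry.Lorentzian Literature.Geometry.Lorentzian.PseudoRiemannianMetric

/-! ## Two elementary lemmas on the rescaling -/

section Pointwise

variable {N : Type} [TopologicalSpace N] [ChartedSpace (EuclideanSpace ℝ (Fin 4)) N]
  [IsManifold (𝓡 4) ∞ N]
  (h : PseudoRiemannianMetric (𝓡 4) ∞ (EuclideanSpace ℝ (Fin 4)) (TangentSpace (𝓡 4) : N → Type _))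
  [h.HasLeviCivita]

/-- The model `ℝ⁴` has dimension `4`. [cite: Besse1987, 1.117–1.118] -/
theorem finrank_euclideanFour : finrank ℝ (EuclideanSpace ℝ (Fin 4)) = 4 :=
  finrank_euclideanSpace_fin

/-- **`|W|²(y) = 0` kills every Weyl component in every orthonormal frame** (a zero sum of squares,
`weylNormSq_eq_weylNormSqFrame_four`). [cite: Besse1987, 1.117] -/
theorem weylFrame_eq_zero_of_weylNormSq_eq_zero {y : N} (hW : h.weylNormSq y = 0)
    {e : Fin 4 → TangentSpace (𝓡 4) y} (he : h.IsOrthonormalFrame y e) (i j k l : Fin 4) :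
    h.weylFrame y e i j k l = 0 := by
  have h0 : h.weylNormSqFrame y e = 0 := by
    rw [← h.weylNormSq_eq_weylNormSqFrame_four finrank_euclideanFour he]; exact hW
  have hle : h.weylFrame y e i j k l ^ 2 ≤ h.weylNormSqFrame y e := by
    unfold weylNormSqFrame
    refine le_trans ?_ (Finset.single_le_sum (f := fun i ↦ ∑ j, ∑ k, ∑ l, h.weylFrame y e i j k l ^ 2)
      (fun _ _ ↦ Finset.sum_nonneg fun _ _ ↦ Finset.sum_nonneg fun _ _ ↦
        Finset.sum_nonneg fun _ _ ↦ sq_nonneg _) (Finset.mem_univ i))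
    refine le_trans ?_ (Finset.single_le_sum (f := fun j ↦ ∑ k, ∑ l, h.weylFrame y e i j k l ^ 2)
      (fun _ _ ↦ Finset.sum_nonneg fun _ _ ↦ Finset.sum_nonneg fun _ _ ↦ sq_nonneg _)
      (Finset.mem_univ j))
    refine le_trans ?_ (Finset.single_le_sum (f := fun k ↦ ∑ l, h.weylFrame y e i j k l ^ 2)
      (fun _ _ ↦ Finset.sum_nonneg fun _ _ ↦ sq_nonneg _) (Finset.mem_univ k))
    exact Finset.single_le_sum (f := fun l ↦ h.weylFrame y e i j k l ^ 2) (fun _ _ ↦ sq_nonneg _)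
      (Finset.mem_univ l)
  exact pow_eq_zero_iff (n := 2) two_ne_zero |>.mp (le_antisymm (h0 ▸ hle) (sq_nonneg _))

/-- **`|Rm|² = |W|² + 2|E|² + R²/6` in dimension four** (Besse 1987, 1.116–1.118; through the tree's
`weylNormSq_eq_curvNormSqWith` and `tracelessRicciNormSq_eq_normSq`). [cite: Besse1987, (1.116)–1.118] -/
theorem curvNormSqWith_eq_weyl_add_traceless_add (hh : h.IsRiemannian) (y : N) :
    h.curvNormSqWith h.leviCivita y =
      h.weylNormSq y + 2 * h.tracelessRicciNormSq y + h.scalarCurvature y ^ 2 / 6 := by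
  rw [h.weylNormSq_eq_curvNormSqWith hh finrank_euclideanFour,
    h.tracelessRicciNormSq_eq_normSq hh finrank_euclideanFour]
  ring

end Pointwise

/-! ## Frame algebra in dimension four -/

end Literature.Geometry.Riemannian.HamiltonPinchedFlow

end Part2

/-!
## Part 3 — port of `Summits/SmoothPoincare4/SmoothPoincare4/Theorems/EntropyRungChangGurskyYangStubCurvatureRatio.lean` (5 declarations kept)

# `R_max / R_min → 1` at the singular time of a pinched maximal Ricci flow (Hamilton 1982, §15, Thm. 15.1; Huisken 1985, §4)

Declarations of this Part (verbatim port; each keeps its own docstring and citation): `ricci_ge_of_pinching`, `curvNormSqWith_le_of_pinching`, `exists_isMax_scalarCurvatureWith`, `exists_lt_scalarCurvatureWith`, `stub_curvatureRatio`.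

References: R. S. Hamilton, *Three-manifolds with positive Ricci curvature*, J. Differential Geom. 17 (1982) 255–306 [Hamilton1982]; G. Huisken, *Ricci deformation of the metric on a Riemannian manifold*, J. Differential Geom. 21 (1985) 47–62 [Huisken1985]; R. S. Hamilton, *Four-manifolds with positive curvature operator*, J. Differential Geom. 24 (1986) 153–179 [Hamilton1986]; P. Topping, *Lectures on the Ricci flow*, LMS Lecture Note Series 325, CUP 2006 [Topping2006].
-/

section Part3

open _root_.Set _root_.Function _root_.Filter _root_.Module
open scoped _root_.Manifold _root_.ContDiff _root_.Topology

namespace Literature.Geometry.Riemannian.HamiltonPinchedFlow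

open Literature.Geometry.Riemannian
open Literature.Geometry.Lorentzian Literature.Geometry.Lorentzian.PseudoRiemannianMetric

/-! ## The flow on a closed 4-manifold: pinching consequences and `R_max → ∞` -/

section Four

variable {M : Type} [TopologicalSpace M] [ChartedSpace (EuclideanSpace ℝ (Fin 4)) M]
  [IsManifold (𝓡 4) ∞ M]

/-- **Pinching makes `Rc ≥ (R/8) g` where `R` is large**: for a Riemannian metric on a `4`-manifold
with `|W|² + 2|E|² ≤ K R^{2−τ}` at `x` (`K, τ > 0`) and `R(x) ≥ R_* := (32K)^{1/τ}`, one has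
`K R^{2−τ} = K R²/R^τ ≤ R²/32`, so `|E|² ≤ R²/64`, `|E| ≤ R/8`, and `Rc ≥ (R/4 − |E|) g ≥ (R/8) g`
(`sub_sqrt_mul_val_le_ricci`). [cite: Hamilton1982, §15, Thm. 15.1 (proof)] [cite: Huisken1985, §4, p. 61] -/
theorem ricci_ge_of_pinching
    (G : PseudoRiemannianMetric (𝓡 4) ∞ (EuclideanSpace ℝ (Fin 4)) (TangentSpace (𝓡 4) : M → Type _))
    [G.HasLeviCivita] (hG : G.IsRiemannian) {K τ : ℝ} (hK : 0 < K) (hτ : 0 < τ) {x : M}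
    (hpin : G.weylNormSq x + 2 * G.tracelessRicciNormSq x ≤ K * G.scalarCurvature x ^ (2 - τ))
    (hlarge : (32 * K) ^ τ⁻¹ ≤ G.scalarCurvature x) (w : TangentSpace (𝓡 4) x) :
    1 / 8 * G.scalarCurvature x * G.val x w w ≤ G.ricci x w w := by
  set S := G.scalarCurvature x with hS
  have hstar0 : 0 < (32 * K) ^ τ⁻¹ := Real.rpow_pos_of_pos (by positivity) _
  have hS0 : 0 < S := hstar0.trans_le hlarge
  -- `S^τ ≥ 32 K`
  have hSτ : 32 * K ≤ S ^ τ := by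
    calc 32 * K = ((32 * K) ^ τ⁻¹) ^ τ := (Real.rpow_inv_rpow (by positivity) hτ.ne').symm
      _ ≤ S ^ τ := Real.rpow_le_rpow hstar0.le hlarge hτ.le
  -- `K S^{2-τ} ≤ S²/32`
  have hKS : K * S ^ (2 - τ) ≤ S ^ 2 / 32 := by
    rw [Real.rpow_sub hS0, Real.rpow_two]
    calc K * (S ^ 2 / S ^ τ) ≤ K * (S ^ 2 / (32 * K)) := by
          gcongr
      _ = S ^ 2 / 32 := by field_simp
  -- `|E| ≤ S/8`
  have hE : Real.sqrt (G.tracelessRicciNormSq x) ≤ S / 8 := by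
    rw [Real.sqrt_le_iff]
    refine ⟨by positivity, ?_⟩
    nlinarith [G.weylNormSq_nonneg x, hpin, hKS]
  have h0 : 0 ≤ G.val x w w := by
    by_cases hw : w = 0
    · simp [hw]
    · exact (hG x w hw).le
  have h := sub_sqrt_mul_val_le_ricci G hG x w
  rw [finrank_euclideanFour] at h
  push_cast at h
  calc 1 / 8 * S * G.val x w w ≤ (S / 4 - Real.sqrt (G.tracelessRicciNormSq x)) * G.val x w w := by
        apply mul_le_mul_of_nonneg_right _ h0
        linarith
    _ ≤ G.ricci x w w := h

/-- **Pinching bounds `|Rm|²` by the scalar curvature**: `|Rm|² = |W|² + 2|E|² + R²/6`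
(`curvNormSqWith_eq_weyl_add_traceless_add`) `≤ K R^{2−τ} + R²/6 ≤ (K + 1/6) R² + K`, since
`R^{2−τ} ≤ R² + 1` for `R > 0`, `0 ≤ 2 − τ ≤ 2`. [cite: Hamilton1986, §5, p. 163] -/
theorem curvNormSqWith_le_of_pinching
    (G : PseudoRiemannianMetric (𝓡 4) ∞ (EuclideanSpace ℝ (Fin 4)) (TangentSpace (𝓡 4) : M → Type _))
    [G.HasLeviCivita] (hG : G.IsRiemannian) {K τ : ℝ} (hK : 0 ≤ K) (hτ : 0 ≤ τ) (hτ2 : τ ≤ 2)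
    {x : M} (hS0 : 0 < G.scalarCurvature x)
    (hpin : G.weylNormSq x + 2 * G.tracelessRicciNormSq x ≤ K * G.scalarCurvature x ^ (2 - τ)) :
    G.curvNormSqWith G.leviCivita x ≤ (K + 1 / 6) * G.scalarCurvature x ^ 2 + K := by
  set S := G.scalarCurvature x with hS
  have hpow : S ^ (2 - τ) ≤ S ^ 2 + 1 := by
    rcases le_or_gt 1 S with h1 | h1
    · calc S ^ (2 - τ) ≤ S ^ (2 : ℝ) := Real.rpow_le_rpow_of_exponent_le h1 (by linarith)
        _ = S ^ 2 := Real.rpow_two S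
        _ ≤ S ^ 2 + 1 := by linarith
    · calc S ^ (2 - τ) ≤ 1 := Real.rpow_le_one hS0.le h1.le (by linarith)
        _ ≤ S ^ 2 + 1 := by nlinarith
  rw [curvNormSqWith_eq_weyl_add_traceless_add G hG x]
  nlinarith [mul_le_mul_of_nonneg_left hpow hK]

variable [CompactSpace M]
  {g : ℝ → PseudoRiemannianMetric (𝓡 4) ∞ (EuclideanSpace ℝ (Fin 4)) (TangentSpace (𝓡 4) : M → Type _)}
  {cov : ℝ → CovariantDerivative (𝓡 4) (EuclideanSpace ℝ (Fin 4)) (TangentSpace (𝓡 4) : M → Type _)}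
  {T : ℝ}

/-- **`R(·, t)` attains its maximum** on the compact nonempty manifold (it is `C^∞`,
`IsLeviCivita.contMDiff_trace_ricci`). [cite: Hamilton1982, §15, Thm. 15.1 (proof)] -/
theorem exists_isMax_scalarCurvatureWith [Nonempty M] {t : ℝ} (hLC : (g t).IsLeviCivita (cov t)) :
    ∃ xm : M, ∀ y : M, (g t).scalarCurvatureWith (cov t) y ≤ (g t).scalarCurvatureWith (cov t) xm := by
  have hcont : Continuous fun y ↦ (g t).scalarCurvatureWith (cov t) y :=
    hLC.contMDiff_trace_ricci.continuous
  obtain ⟨xm, -, hxm⟩ := isCompact_univ.exists_isMaxOn univ_nonempty hcont.continuousOn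
  exact ⟨xm, fun y ↦ hxm (mem_univ y)⟩

variable [T2Space M] [SecondCountableTopology M]

/-- **`R_max(t) → ∞` as `t → T` for a pinched maximal flow** (Hamilton 1982, Thm. 14.1 / Topping
2006, Thm. 5.3.1, in the liminf sense): for every level `L` there is `t₀ < T` such that at every
`t ∈ [t₀, T)` the scalar curvature exceeds `L` somewhere. The curvature blow-up (tree theorem
`ricciFlow_curvature_blowup_of_shortTime ricciFlow_shortTime_existence_holds`) denies the frame
bound `√c`, `c = (K + 1/6) L² + K`, at all late times; were `R ≤ L` everywhere at such a time,
`|Rm|² ≤ c` (`curvNormSqWith_le_of_pinching`) would give that frame bound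
(`curvatureBoundedBy_of_curvNormSqWith_le`). [cite: Hamilton1982, §14, Thm. 14.1] [cite: Topping2006, Thm. 5.3.1] -/
theorem exists_lt_scalarCurvatureWith (hmax : IsMaximalRicciFlow g cov T) {m K τ : ℝ} (hm : 0 < m)
    (hK : 0 < K) (hτ : 0 < τ) (hτ1 : τ ≤ 1)
    (hpinch : ∀ t ∈ Ico 0 T, ∀ [(g t).HasLeviCivita] (x : M),
      m ≤ (g t).scalarCurvature x ∧
        (g t).weylNormSq x + 2 * (g t).tracelessRicciNormSq x ≤
          K * (g t).scalarCurvature x ^ (2 - τ))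
    (L : ℝ) : ∃ t₀ ∈ Ico 0 T, ∀ t ∈ Ico t₀ T, ∃ x : M, L < (g t).scalarCurvatureWith (cov t) x := by
  have h2 : (2 : ℕ∞ω) ≤ ∞ := WithTop.coe_le_coe.mpr le_top
  set L' := max L 0 with hL'
  have hL'0 : 0 ≤ L' := le_max_right _ _
  set c : ℝ := (K + 1 / 6) * L' ^ 2 + K with hc
  obtain ⟨t₀, ht₀, hblow⟩ := ricciFlow_curvature_blowup_of_shortTime
    ricciFlow_shortTime_existence_holds (𝓡 4) M T g cov hmax (Real.sqrt c)
  refine ⟨t₀, ht₀, fun t ht ↦ ?_⟩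
  have ht' : t ∈ Ico 0 T := ⟨ht₀.1.trans ht.1, ht.2⟩
  have hR := hmax.isRiemannian t ht'
  have hLC := hmax.isRicciFlow.isLeviCivita t ht'
  haveI := (g t).hasLeviCivita
  by_contra hcon
  push Not at hcon
  refine hblow t ht (curvatureBoundedBy_of_curvNormSqWith_le hR hLC fun x ↦ ?_)
  -- at `x`: `R ≤ L ≤ L'`, so `|Rm|² ≤ (K + 1/6) R² + K ≤ c`
  have hscal : (g t).scalarCurvatureWith (cov t) x = (g t).scalarCurvature x := by
    show (g t).trace x ((cov t).ricci x) = (g t).trace x ((g t).ricci x)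
    rw [hLC.ricci_eq_ricci h2 x]
  obtain ⟨hmS, hpin⟩ := hpinch t ht' x
  have hS0 : 0 < (g t).scalarCurvature x := hm.trans_le hmS
  have hSL : (g t).scalarCurvature x ≤ L' := (hscal ▸ hcon x).trans (le_max_left _ _)
  rw [(g t).curvNormSqWith_congr (hLC.curvature_eq_riemann h2 x)]
  calc (g t).curvNormSqWith (g t).leviCivita x
      ≤ (K + 1 / 6) * (g t).scalarCurvature x ^ 2 + K :=
        curvNormSqWith_le_of_pinching (g t) hR hK.le hτ.le (by linarith) hS0 hpin
    _ ≤ (K + 1 / 6) * L' ^ 2 + K := by gcongr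
    _ = c := rfl

end Four

/-! ## `R_max / R_min → 1` -/

/-- **`R_max/R_min → 1` AS `t → T` (Hamilton 1982, Thm. 15.1; Huisken 1985, §4 end).** For
the maximal (finite-time) Ricci flow on a closed connected 4-manifold with the invariant pinching
`m ≤ R`, `|W|² + 2|E|² ≤ K R^{2−τ}` and the gradient estimate `∀ η > 0 ∃ C, |∇R|² ≤ η R³ + C`
(Hamilton 1982, Thm. 11.1): for every `θ ∈ (0, 1)` there is `t₀ < T` with `θ R(y, t) ≤ R(x, t)` for
all `x, y` and all `t ∈ [t₀, T)`. Proof: `R_max(t) → ∞` (`exists_lt_scalarCurvatureWith`, curvature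
blow-up), `Rc ≥ (R/8) g` where `R ≥ R_*` (`ricci_ge_of_pinching`), and Hamilton's geometric step
with localised Ricci hypothesis (`helper_curvatureRatio_localMyers`, Aux file) at the maximum point
of `R(·, t)` with `η' = min (1−θ) (1/30)`,
`η = η'⁴/2`, at times so late that `η R_max³ + C ≤ η'⁴ R_max³` and `(1 − η') R_max ≥ R_*`.
[cite: Hamilton1982, §15, Thm. 15.1 and Thm. 15.2] [cite: Huisken1985, §4, p. 61] -/
theorem stub_curvatureRatio :
    ∀ (M : Type) [TopologicalSpace M] [T2Space M] [SecondCountableTopology M]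
      [ChartedSpace (EuclideanSpace ℝ (Fin 4)) M] [IsManifold (𝓡 4) ∞ M] [CompactSpace M]
      [ConnectedSpace M]
      (g : ℝ → PseudoRiemannianMetric (𝓡 4) ∞ (EuclideanSpace ℝ (Fin 4)) (TangentSpace (𝓡 4) : M → Type _))
      (cov : ℝ → CovariantDerivative (𝓡 4) (EuclideanSpace ℝ (Fin 4)) (TangentSpace (𝓡 4) : M → Type _))
      (T m K τ : ℝ), 0 < m → 0 < K → 0 < τ → τ ≤ 1 →
      IsMaximalRicciFlow g cov T →
      (∀ t ∈ Ico 0 T, ∀ [(g t).HasLeviCivita] (x : M),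
        m ≤ (g t).scalarCurvature x ∧
          (g t).weylNormSq x + 2 * (g t).tracelessRicciNormSq x ≤
            K * (g t).scalarCurvature x ^ (2 - τ)) →
      (∀ η : ℝ, 0 < η → ∃ C : ℝ, ∀ t ∈ Ico 0 T, ∀ x : M,
        (g t).gradSq (fun y ↦ (g t).scalarCurvatureWith (cov t) y) x ≤
          η * (g t).scalarCurvatureWith (cov t) x ^ 3 + C) →
      ∀ θ : ℝ, 0 < θ → θ < 1 → ∃ t₀ ∈ Ico 0 T, ∀ t ∈ Ico t₀ T, ∀ x y : M,
        θ * (g t).scalarCurvatureWith (cov t) y ≤ (g t).scalarCurvatureWith (cov t) x := by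
  intro M _ _ _ _ _ _ _ g cov T m K τ hm hK hτ0 hτ1 hmax hpinch hgrad θ hθ hθ1
  have h2 : (2 : ℕ∞ω) ≤ ∞ := WithTop.coe_le_coe.mpr le_top
  -- the constants `η'`, `η = η'⁴/2`, `R_*`, and the level `L`
  set η' : ℝ := min (1 - θ) (1 / 30) with hη'
  have hη'0 : 0 < η' := lt_min (by linarith) (by norm_num)
  have hη'θ : η' ≤ 1 - θ := min_le_left _ _
  have hη'30 : η' ≤ 1 / 30 := min_le_right _ _
  have hη'1 : η' < 1 := by linarith
  have h1η : 0 < 1 - η' := by linarith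
  have hsmall : Real.pi ^ 2 * 3 * η' ^ 2 < 1 / 8 * (1 - η') := by
    have hπ := Real.pi_lt_four
    have hπ0 := Real.pi_pos
    have hη'sq : η' ^ 2 ≤ (1 / 30) ^ 2 := pow_le_pow_left₀ hη'0.le hη'30 2
    have hπsq : Real.pi ^ 2 < 4 ^ 2 := pow_lt_pow_left₀ hπ hπ0.le two_ne_zero
    nlinarith
  obtain ⟨C, hC⟩ := hgrad (η' ^ 4 / 2) (by positivity)
  set Rstar : ℝ := (32 * K) ^ τ⁻¹ with hRstar
  have hRstar0 : 0 < Rstar := Real.rpow_pos_of_pos (by positivity) _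
  set L : ℝ := 1 + (2 * |C| / η' ^ 4 + 1) + Rstar / (1 - η') with hL
  have hLa : 0 ≤ 2 * |C| / η' ^ 4 := by positivity
  have hLb : 0 ≤ Rstar / (1 - η') := by positivity
  have hL1 : 1 ≤ L := by rw [hL]; linarith
  have hLC : 2 * |C| ≤ η' ^ 4 * L := by
    have h1 : 2 * |C| / η' ^ 4 ≤ L := by rw [hL]; linarith
    rw [div_le_iff₀ (by positivity)] at h1
    linarith
  have hLstar : Rstar ≤ (1 - η') * L := by
    have h1 : Rstar / (1 - η') ≤ L := by rw [hL]; linarith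
    rw [div_le_iff₀ h1η] at h1
    linarith
  -- late times at which `R` exceeds `L` somewhere
  obtain ⟨t₀, ht₀, hlarge⟩ := exists_lt_scalarCurvatureWith hmax hm hK hτ0 hτ1 hpinch L
  refine ⟨t₀, ht₀, fun t ht x y ↦ ?_⟩
  have ht' : t ∈ Ico 0 T := ⟨ht₀.1.trans ht.1, ht.2⟩
  have hRiem := hmax.isRiemannian t ht'
  have hLCt := hmax.isRicciFlow.isLeviCivita t ht'
  haveI := (g t).hasLeviCivita
  -- dictionary at time `t`
  have hscal : ∀ z : M, (g t).scalarCurvatureWith (cov t) z = (g t).scalarCurvature z := by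
    intro z
    show (g t).trace z ((cov t).ricci z) = (g t).trace z ((g t).ricci z)
    rw [hLCt.ricci_eq_ricci h2 z]
  set R : M → ℝ := fun z ↦ (g t).scalarCurvatureWith (cov t) z with hRdef
  have hRm : ∀ z, m ≤ R z := fun z ↦ by
    show m ≤ (g t).scalarCurvatureWith (cov t) z
    rw [hscal z]
    exact (hpinch t ht' z).1
  have hRpos : ∀ z, 0 < R z := fun z ↦ hm.trans_le (hRm z)
  -- the maximum point `xm` of `R(·, t)`; `R xm > L`
  obtain ⟨xm, hxm⟩ : ∃ xm : M, ∀ z, R z ≤ R xm := exists_isMax_scalarCurvatureWith hLCt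
  obtain ⟨x₀, hx₀⟩ := hlarge t ht
  have hLR : L < R xm := hx₀.trans_le (hxm x₀)
  have hpos : 0 < R xm := hRpos xm
  have hR3 : R xm ≤ R xm ^ 3 := by
    have h1 : 1 ≤ R xm := hL1.trans hLR.le
    simpa using pow_le_pow_right₀ h1 (show 1 ≤ 3 by norm_num)
  -- differentiability of `R`
  have hRdiff : ∀ z, MDifferentiableAt (𝓡 4) 𝓘(ℝ, ℝ) R z := fun z ↦
    hLCt.contMDiff_trace_ricci.mdifferentiableAt (by simp)
  -- the gradient bound `|dR(w)| ≤ η'² R_max^{3/2} |w|`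
  have hA0 : 0 ≤ η' ^ 2 * (R xm * Real.sqrt (R xm)) := by positivity
  have hAsq : (η' ^ 2 * (R xm * Real.sqrt (R xm))) ^ 2 = η' ^ 4 * R xm ^ 3 := by
    rw [mul_pow, mul_pow, Real.sq_sqrt hpos.le]
    ring
  have hgrad' : ∀ (z : M) (w : TangentSpace (𝓡 4) z),
      |mvfderiv (𝓡 4) R z w| ≤ η' ^ 2 * (R xm * Real.sqrt (R xm)) * Real.sqrt ((g t).val z w w) := by
    intro z w
    have h1 := abs_mvfderiv_le_sqrt_gradSq_mul_sqrt (g t) hRiem R z w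
    have h2 : (g t).gradSq R z ≤ η' ^ 4 * R xm ^ 3 := by
      have h3 : (g t).gradSq R z ≤ η' ^ 4 / 2 * R z ^ 3 + C := hC t ht' z
      have h4 : R z ^ 3 ≤ R xm ^ 3 := pow_le_pow_left₀ (hRpos z).le (hxm z) 3
      have h5 : C ≤ η' ^ 4 / 2 * R xm ^ 3 := by
        have h6 : η' ^ 4 * L ≤ η' ^ 4 * R xm ^ 3 :=
          mul_le_mul_of_nonneg_left (hLR.le.trans hR3) (by positivity)
        linarith [le_abs_self C]
      have h7 : η' ^ 4 / 2 * R z ^ 3 ≤ η' ^ 4 / 2 * R xm ^ 3 :=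
        mul_le_mul_of_nonneg_left h4 (by positivity)
      linarith
    have h3 : Real.sqrt ((g t).gradSq R z) ≤ η' ^ 2 * (R xm * Real.sqrt (R xm)) := by
      rw [← Real.sqrt_sq hA0, hAsq]
      exact Real.sqrt_le_sqrt h2
    exact h1.trans (mul_le_mul_of_nonneg_right h3 (Real.sqrt_nonneg _))
  -- the localised Ricci bound `Rc ≥ (R/8) g` where `R ≥ (1 - η') R_max (≥ R_*)`
  have hRic' : ∀ (z : M) (w : TangentSpace (𝓡 4) z), (1 - η') * R xm ≤ R z →
      1 / 8 * R z * (g t).val z w w ≤ (g t).ricci z w w := by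
    intro z w hz
    have hzstar : Rstar ≤ (g t).scalarCurvature z := by
      rw [← hscal z]
      have h1 : (1 - η') * L ≤ (1 - η') * R xm := mul_le_mul_of_nonneg_left hLR.le h1η.le
      exact hLstar.trans (h1.trans hz)
    have h := ricci_ge_of_pinching (g t) hRiem hK hτ0 (hpinch t ht' z).2 hzstar w
    rw [← hscal z] at h
    exact h
  -- Hamilton's geometric step at the maximum point
  have key : (1 - η') * R xm ≤ R x :=
    helper_curvatureRatio_localMyers M (g t) hRiem R xm η' (1 / 8) hRdiff hpos hη'0 hη'1
      (by norm_num) hsmall hgrad' hRic' x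
  calc θ * R y ≤ θ * R xm := mul_le_mul_of_nonneg_left (hxm y) hθ.le
    _ ≤ (1 - η') * R xm := mul_le_mul_of_nonneg_right (by linarith) hpos.le
    _ ≤ R x := key

end Literature.Geometry.Riemannian.HamiltonPinchedFlow

end Part3

/-!
## Part 4 — port of `Summits/SmoothPoincare4/SmoothPoincare4/Theorems/EntropyRungChangGurskyYangStubRoundnessRateAux2.lean` (3 declarations kept)

# Oscillation decay of the scalar curvature of a pinched Type-I Ricci flow (Hamilton 1982, §15, Thm. 15.1–15.2; Myers' theorem)

Declarations of this Part (verbatim port; each keeps its own docstring and citation): `ricci_ge_of_tracelessRicciNormSq`, `abs_sub_mul_sqrt_le_of_mfderiv_le`, `helper_roundnessOscillation`.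

References: R. S. Hamilton, *Three-manifolds with positive Ricci curvature*, J. Differential Geom. 17 (1982) 255–306 [Hamilton1982]; S. B. Myers, *Riemannian manifolds with positive mean curvature*, Duke Math. J. 8 (1941) 401–404 [Myers1941].
-/

section Part4

open _root_.Set _root_.Function _root_.Filter
open scoped _root_.Manifold _root_.ContDiff _root_.Topology

namespace Literature.Geometry.Riemannian.HamiltonPinchedFlow

open Literature.Geometry.Riemannian
open Literature.Geometry.Lorentzian Literature.Geometry.Lorentzian.PseudoRiemannianMetric

section Frame

variable {E : Type*} [NormedAddCommGroup E] [NormedSpace ℝ E] [FiniteDimensional ℝ E]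
  {H : Type*} [TopologicalSpace H] {I : ModelWithCorners ℝ E H}
  {M : Type*} [TopologicalSpace M] [ChartedSpace H M] [IsManifold I ∞ M] {n : ℕ∞ω}
  (g : PseudoRiemannianMetric I n E (TangentSpace I : M → Type _)) [g.HasLeviCivita]

/-- **The trace-free Ricci tensor controls the Ricci tensor from below** (dimension `4`):
`Ric(w, w) ≥ (R/4 − |E|)·g(w, w)` with `|E| = √(|E|²)` (Hamilton 1982, §15: "`R_ij ≥ εRg_ij`"
from the pinching; Huisken 1985, §5). For a unit `w`, extend it to an orthonormal frame `e` with
`e₀ = w`; then `(Ric(w,w) − R/4)² = E₀₀² ≤ Σ_{ab} E_{ab}² = |E|²`. [cite: Hamilton1982, §15, Thm. 15.1 (proof)] -/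
theorem ricci_ge_of_tracelessRicciNormSq (hg : g.IsRiemannian) (hE : Module.finrank ℝ E = 4)
    (x : M) (w : TangentSpace I x) :
    (g.scalarCurvature x / 4 - Real.sqrt (g.tracelessRicciNormSq x)) * g.val x w w ≤
      g.ricci x w w := by
  classical
  have hpos : ∀ v : TangentSpace I x, v ≠ 0 → 0 < g.val x v v := fun v hv ↦ hg x v hv
  -- unit vectors
  have hunit : ∀ u : TangentSpace I x, g.val x u u = 1 →
      g.scalarCurvature x / 4 - Real.sqrt (g.tracelessRicciNormSq x) ≤ g.ricci x u u := by
    intro u hu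
    obtain ⟨e, he, he0⟩ := g.exists_isOrthonormalFrame_extend hpos hE (fun _ ↦ u) {0}
      (fun _ _ ↦ hu) (fun i hi j hj hij ↦ absurd (hi.trans hj.symm) hij)
    have h0 : e 0 = u := he0 0 rfl
    have hsq : g.tracelessRicciFrame x e 0 0 ^ 2 ≤ g.tracelessRicciNormSq x := by
      rw [g.tracelessRicciNormSq_eq_tracelessRicciNormSqFrame_four hE he]
      unfold tracelessRicciNormSqFrame
      refine le_trans ?_ (Finset.single_le_sum
        (f := fun a ↦ ∑ b, g.tracelessRicciFrame x e a b ^ 2)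
        (fun _ _ ↦ Finset.sum_nonneg fun _ _ ↦ sq_nonneg _) (Finset.mem_univ 0))
      exact Finset.single_le_sum (f := fun b ↦ g.tracelessRicciFrame x e 0 b ^ 2)
        (fun _ _ ↦ sq_nonneg _) (Finset.mem_univ 0)
    have hval : g.tracelessRicciFrame x e 0 0 = g.ricci x u u - g.scalarCurvature x / 4 := by
      rw [tracelessRicciFrame_apply, h0, Fintype.card_fin, frameDelta_self]
      push_cast
      ring
    have habs : |g.ricci x u u - g.scalarCurvature x / 4| ≤
        Real.sqrt (g.tracelessRicciNormSq x) := by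
      rw [← hval]; exact Real.abs_le_sqrt hsq
    linarith [(abs_le.1 habs).1]
  by_cases hw : w = 0
  · subst hw; simp
  have hww : 0 < g.val x w w := hpos w hw
  set ℓ := Real.sqrt (g.val x w w) with hℓ
  have hℓpos : 0 < ℓ := Real.sqrt_pos.2 hww
  have hℓsq : ℓ ^ 2 = g.val x w w := Real.sq_sqrt hww.le
  set u : TangentSpace I x := ℓ⁻¹ • w with hu'
  have hu : g.val x u u = 1 := by
    have h1 : g.val x u u = ℓ⁻¹ * ℓ⁻¹ * g.val x w w := by
      rw [hu']
      simp only [map_smul, FunLike.coe_smul, Pi.smul_apply, smul_eq_mul]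
      ring
    rw [h1, ← hℓsq]
    field_simp
  have hwu : w = ℓ • u := by rw [hu', smul_smul, mul_inv_cancel₀ hℓpos.ne', one_smul]
  have hric : g.ricci x w w = ℓ ^ 2 * g.ricci x u u := by
    rw [hwu]
    simp only [map_smul, LinearMap.smul_apply, smul_eq_mul]
    ring
  rw [hric, ← hℓsq, mul_comm]
  exact mul_le_mul_of_nonneg_left (hunit u hu) (sq_nonneg ℓ)

end Frame

section Oscillation

variable {E : Type*} [NormedAddCommGroup E] [NormedSpace ℝ E] [FiniteDimensional ℝ E]
  [CompleteSpace E] {M : Type*} [TopologicalSpace M] [ChartedSpace E M] [IsManifold 𝓘(ℝ, E) ∞ M]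
  [T2Space M] [CompactSpace M] [ConnectedSpace M]
  (g : PseudoRiemannianMetric 𝓘(ℝ, E) ∞ E (TangentSpace 𝓘(ℝ, E) : M → Type _)) [g.HasLeviCivita]

/-- **Oscillation bound from a gradient bound and Myers' theorem** (the argument of Hamilton 1982,
Thm. 15.1 / Cor. 17.5): on a compact connected boundaryless manifold of dimension `≥ 2` with a
smooth Riemannian metric, if `|df_z(w)| ≤ A|w|_g` (`A ≥ 0`) and `Rc(w,w) ≥ (dim M − 1)k g(w,w)`,
`k > 0`, then `|f(y) − f(x)|·√k ≤ Aπ` for all `x, y`. Join `x` to `y` by a minimizing geodesic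
`γ_v|[0,1]` (Hopf–Rinow, `exists_isMinimizingUpTo_of_isGeodesicallyComplete`; compact ⇒ complete,
`hopfRinow_compact_geodesicallyComplete`) of length `ℓ = |v|`; along its unit-speed
reparametrisation `|f(y) − f(x)| ≤ Aℓ` (`abs_sub_le_mul_of_mfderiv_le`) and `ℓ√k ≤ π` (Myers,
`length_mul_sqrt_le_pi_of_isMinimizingUpTo`). [cite: Hamilton1982, §15, Thm. 15.1–15.2]
[cite: Myers1941] -/
theorem abs_sub_mul_sqrt_le_of_mfderiv_le (hg : g.IsRiemannian)
    (hdim : 2 ≤ Module.finrank ℝ E) {f : M → ℝ}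
    (hf : ∀ y, MDifferentiableAt 𝓘(ℝ, E) 𝓘(ℝ, ℝ) f y) {A : ℝ} (hA0 : 0 ≤ A)
    (hA : ∀ (y : M) (w : TangentSpace 𝓘(ℝ, E) y),
      |(show ℝ from mfderiv 𝓘(ℝ, E) 𝓘(ℝ, ℝ) f y w)| ≤ A * Real.sqrt (g.val y w w))
    {k : ℝ} (hk : 0 < k)
    (hRic : ∀ (x : M) (w : TangentSpace 𝓘(ℝ, E) x),
      ((Module.finrank ℝ E : ℝ) - 1) * k * g.val x w w ≤ g.leviCivita.ricci x w w)
    (x y : M) : |f y - f x| * Real.sqrt k ≤ A * Real.pi := by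
  have hLC := PseudoRiemannianMetric.isLeviCivita_leviCivita_holds (g := g)
  have hk1 : ((1 : ℕ∞) : ℕ∞ω) + 1 ≤ ∞ := by
    rw [show ((1 : ℕ∞) : ℕ∞ω) + 1 = 2 by norm_num]
    exact WithTop.coe_le_coe.2 le_top
  haveI : CovariantDerivative.ContMDiffCovariantDerivative g.leviCivita 1 :=
    ⟨g.isLocallyContMDiff_leviCivita_holds 1 hk1 univ isOpen_univ⟩
  haveI : CovariantDerivative.ContMDiffCovariantDerivative g.leviCivita ∞ :=
    ⟨g.isLocallyContMDiff_leviCivita_holds ⊤ (le_of_eq rfl) univ isOpen_univ⟩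
  have hc : IsGeodesicallyComplete g.leviCivita := hopfRinow_compact_geodesicallyComplete le_rfl hg
  have hAπ : 0 ≤ A * Real.pi := by positivity
  obtain ⟨v, hmin, hyv⟩ := exists_isMinimizingUpTo_of_isGeodesicallyComplete g le_rfl hg hc x y
  have hvv0 : 0 ≤ g.val x v v := by
    by_cases hv : v = 0
    · simp [hv]
    · exact (hg x v hv).le
  set ℓ := Real.sqrt (g.val x v v) with hℓ
  rcases (show 0 ≤ ℓ from Real.sqrt_nonneg _).eq_or_lt with hℓ0 | hℓpos
  · -- `y = x`
    have hv0 : v = 0 := by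
      by_contra hv
      have h2 : 0 < ℓ := Real.sqrt_pos.2 (hg x v hv)
      linarith
    have hyx : y = x := by
      rw [← hyv, hv0]
      exact riemannianExpMap_zero g x
    rw [hyx, sub_self, abs_zero, zero_mul]
    exact hAπ
  -- unit-speed reparametrisation `u = ℓ⁻¹ v`, minimizing up to `ℓ`, ending at `y`
  have hvv : g.val x v v = ℓ ^ 2 := (Real.sq_sqrt hvv0).symm
  set u : TangentSpace 𝓘(ℝ, E) x := ℓ⁻¹ • v with hu'
  have hu : g.val x u u = 1 := by
    have h1 : g.val x u u = ℓ⁻¹ * ℓ⁻¹ * g.val x v v := by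
      rw [hu']
      simp only [map_smul, FunLike.coe_smul, Pi.smul_apply, smul_eq_mul]
      ring
    rw [h1, hvv]
    field_simp
  have hminu : IsMinimizingUpTo g hg x u ℓ := by
    rw [hu', isMinimizingUpTo_smul_iff hg hc x v (inv_pos.2 hℓpos), inv_mul_cancel₀ hℓpos.ne']
    exact hmin
  have hγℓ : maximalGeodesic g.leviCivita x u ℓ = y := by
    rw [hu', maximalGeodesic_smul hc x v ℓ⁻¹ ℓ, inv_mul_cancel₀ hℓpos.ne', ← hyv]
    exact (expMap_eq_maximalGeodesic hc x v).symm
  -- the gradient bound along `γ_u`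
  have h1 : |f y - f x| ≤ A * ℓ := by
    have h := abs_sub_le_mul_of_mfderiv_le g hc hf hA x u hu hℓpos.le
    rwa [hγℓ] at h
  -- Myers: `ℓ √k ≤ π`
  obtain ⟨-, hgeo, hγ0, hγu⟩ := maximalGeodesic_of_isGeodesicallyComplete hc x u
  have hspeed : ∀ t, g.val (maximalGeodesic g.leviCivita x u t)
      (velocity 𝓘(ℝ, E) (maximalGeodesic g.leviCivita x u) t)
      (velocity 𝓘(ℝ, E) (maximalGeodesic g.leviCivita x u) t) = 1 := by
    intro t
    rw [g.val_velocity_eq_of_isGeodesicOn_of_isCompatible hLC.2 isOpen_univ Set.ordConnected_univ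
      hgeo (mem_univ t) (mem_univ 0), hγu]
    have h0 : maximalGeodesic g.leviCivita x u 0 = x := hγ0
    rw [h0]
    exact hu
  have hRic' : ∀ t ∈ Ioo 0 ℓ, ((Module.finrank ℝ E : ℝ) - 1) * k ≤
      g.leviCivita.ricci (maximalGeodesic g.leviCivita x u t)
        (velocity 𝓘(ℝ, E) (maximalGeodesic g.leviCivita x u) t)
        (velocity 𝓘(ℝ, E) (maximalGeodesic g.leviCivita x u) t) := by
    intro t _
    have h := hRic _ (velocity 𝓘(ℝ, E) (maximalGeodesic g.leviCivita x u) t)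
    rwa [hspeed t, mul_one] at h
  have hle := length_mul_sqrt_le_pi_of_isMinimizingUpTo g hg hdim hc x u hu hk hℓpos hminu hRic'
  calc |f y - f x| * Real.sqrt k ≤ A * ℓ * Real.sqrt k :=
        mul_le_mul_of_nonneg_right h1 (Real.sqrt_nonneg _)
    _ = A * (ℓ * Real.sqrt k) := by ring
    _ ≤ A * Real.pi := mul_le_mul_of_nonneg_left hle hA0

end Oscillation

/-! ## Dimension four: the oscillation of `R` along a pinched Type-I flow -/

/-- **HELPER — OSCILLATION DECAY `(T−t)(R_max − R_min) ≤ C(T−t)^{δ₁/2}`** (Hamilton 1982, §17,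
Lemma 17.4 ⇒ Cor. 17.5 in unnormalised clothes, via the argument of Thm. 15.1; feeds
`stub_roundnessRate`). Along a Ricci flow of Riemannian metrics on `[0, T)` on a closed
connected 4-manifold with the invariant pinching `m ≤ R`, `|W|² + 2|E|² ≤ K R^{2−τ}`, suppose on
`[t₀, T)`: `(T−t)R ≥ 1`, `K R^{−τ} ≤ 1/20`, and `|∇R|² ≤ C₁(T−t)^{δ₁−3}`. Then for
`t ∈ [t₀, T)` and all `x, y`: `(T−t)|R(x,t) − R(y,t)| ≤ 6π√(max C₁ 0)(T−t)^{δ₁/2}`. Proof, with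
`h = T − t`: `|E|² ≤ (K/2)R^{−τ}R² ≤ R²/40 ≤ (R/6)²`, so `Ric ≥ (R/4 − R/6)g ≥ g/(12h)`
(`ricci_ge_of_tracelessRicciNormSq`, `R ≥ 1/h`), i.e. `Ric ≥ 3k g`, `k = 1/(36h)`, `√k = 1/(6√h)`;
`|dR(w)| ≤ √(C₁' h^{δ₁−3})|w|` (`abs_mvfderiv_le_sqrt_gradSq_mul_sqrt`); so
`|R(x) − R(y)|/(6√h) ≤ π√C₁'√(h^{δ₁−3})` (`abs_sub_mul_sqrt_le_of_mfderiv_le`) and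
`h·√h·√(h^{δ₁−3}) = h^{δ₁/2}`. [cite: Hamilton1982, §17, Lemma 17.4 and Cor. 17.5; §15, Thm. 15.1] -/
theorem helper_roundnessOscillation :
    ∀ (M : Type) [TopologicalSpace M] [T2Space M] [SecondCountableTopology M]
      [ChartedSpace (EuclideanSpace ℝ (Fin 4)) M] [IsManifold (𝓡 4) ∞ M] [CompactSpace M]
      [ConnectedSpace M]
      (g : ℝ → PseudoRiemannianMetric (𝓡 4) ∞ (EuclideanSpace ℝ (Fin 4)) (TangentSpace (𝓡 4) : M → Type _))
      (cov : ℝ → CovariantDerivative (𝓡 4) (EuclideanSpace ℝ (Fin 4)) (TangentSpace (𝓡 4) : M → Type _))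
      (T m K τ t₀ C₁ δ₁ : ℝ), 0 < m →
      IsRicciFlow g cov (Ico 0 T) → (∀ t ∈ Ico 0 T, (g t).IsRiemannian) →
      (∀ t ∈ Ico 0 T, ∀ [(g t).HasLeviCivita] (x : M),
        m ≤ (g t).scalarCurvature x ∧
          (g t).weylNormSq x + 2 * (g t).tracelessRicciNormSq x ≤
            K * (g t).scalarCurvature x ^ (2 - τ)) →
      t₀ ∈ Ico 0 T →
      (∀ t ∈ Ico t₀ T, ∀ x : M, 1 ≤ (T - t) * (g t).scalarCurvatureWith (cov t) x ∧
        K * (g t).scalarCurvatureWith (cov t) x ^ (-τ) ≤ 1 / 20) →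
      (∀ t ∈ Ico t₀ T, ∀ x : M,
        (g t).gradSq (fun y ↦ (g t).scalarCurvatureWith (cov t) y) x ≤ C₁ * (T - t) ^ (δ₁ - 3)) →
      ∀ t ∈ Ico t₀ T, ∀ x y : M,
        (T - t) * |(g t).scalarCurvatureWith (cov t) x - (g t).scalarCurvatureWith (cov t) y| ≤
          6 * Real.pi * Real.sqrt (max C₁ 0) * (T - t) ^ (δ₁ / 2) := by
  intro M _ _ _ _ _ _ _ g cov T m K τ t₀ C₁ δ₁ hm hflow hRiem hpinch ht₀ htype hgrad t ht x y
  have ht' : t ∈ Ico 0 T := ⟨ht₀.1.trans ht.1, ht.2⟩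
  set h := T - t with hh
  have hh0 : 0 < h := sub_pos.2 ht.2
  haveI := (g t).hasLeviCivita
  have hg : (g t).IsRiemannian := hRiem t ht'
  have h2 : (2 : ℕ∞ω) ≤ ∞ := WithTop.coe_le_coe.mpr le_top
  have hLC := hflow.isLeviCivita t ht'
  have hric : ∀ z : M, (cov t).ricci z = (g t).ricci z := fun z ↦ hLC.ricci_eq_ricci h2 z
  have hscal : ∀ z : M, (g t).scalarCurvatureWith (cov t) z = (g t).scalarCurvature z := by
    intro z
    show (g t).trace z ((cov t).ricci z) = (g t).trace z ((g t).ricci z)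
    rw [hric z]
  set f : M → ℝ := fun z ↦ (g t).scalarCurvatureWith (cov t) z with hf
  -- the gradient bound `|df(w)| ≤ A |w|`, `A = √C₁' · √(h^{δ₁-3})`
  set C₁' := max C₁ 0 with hC₁'
  have hC₁'0 : 0 ≤ C₁' := le_max_right _ _
  set A := Real.sqrt C₁' * Real.sqrt (h ^ (δ₁ - 3)) with hA
  have hA0 : 0 ≤ A := by positivity
  have hfd : ∀ z, MDifferentiableAt (𝓡 4) 𝓘(ℝ, ℝ) f z := fun z ↦
    hLC.contMDiff_trace_ricci.mdifferentiableAt (by simp)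
  have hAf : ∀ (z : M) (w : TangentSpace (𝓡 4) z),
      |(show ℝ from mfderiv (𝓡 4) 𝓘(ℝ, ℝ) f z w)| ≤ A * Real.sqrt ((g t).val z w w) := by
    intro z w
    have h1 := abs_mvfderiv_le_sqrt_gradSq_mul_sqrt (g t) hg f z w
    have h2 : (g t).gradSq f z ≤ C₁' * h ^ (δ₁ - 3) :=
      (hgrad t ht z).trans (mul_le_mul_of_nonneg_right (le_max_left _ _)
        (Real.rpow_nonneg hh0.le _))
    have h3 : Real.sqrt ((g t).gradSq f z) ≤ A := by
      rw [hA, ← Real.sqrt_mul hC₁'0]; exact Real.sqrt_le_sqrt h2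
    exact h1.trans (mul_le_mul_of_nonneg_right h3 (Real.sqrt_nonneg _))
  -- the Ricci lower bound `Ric ≥ 3k g`, `k = 1/(36h)`
  set k : ℝ := 1 / (36 * h) with hk
  have hk0 : 0 < k := by positivity
  have hRic : ∀ (z : M) (w : TangentSpace (𝓡 4) z),
      ((Module.finrank ℝ (EuclideanSpace ℝ (Fin 4)) : ℝ) - 1) * k * (g t).val z w w ≤
        (g t).leviCivita.ricci z w w := by
    intro z w
    obtain ⟨h1R, hKR⟩ := htype t ht z
    set R := (g t).scalarCurvatureWith (cov t) z with hR
    have hR0 : 0 < R := by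
      by_contra hcon
      push Not at hcon
      nlinarith
    -- `|E|² ≤ R²/40`
    have hEsq : (g t).tracelessRicciNormSq z ≤ (R / 6) ^ 2 := by
      obtain ⟨-, -, hWnn, hp⟩ : m ≤ R ∧
          0 ≤ (g t).normSq z ((cov t).ricci z) - R ^ 2 / 4 ∧
          0 ≤ (g t).curvNormSqWith (cov t) z - 2 * (g t).normSq z ((cov t).ricci z) + R ^ 2 / 3 ∧
          ((g t).curvNormSqWith (cov t) z - 2 * (g t).normSq z ((cov t).ricci z) + R ^ 2 / 3) +
            2 * ((g t).normSq z ((cov t).ricci z) - R ^ 2 / 4) ≤ K * R ^ (2 - τ) := by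
        have hcurv : (g t).curvNormSqWith (cov t) z = (g t).curvNormSqWith (g t).leviCivita z :=
          (g t).curvNormSqWith_congr (hLC.curvature_eq_riemann h2 z)
        have hE := (g t).tracelessRicciNormSq_eq_normSq hg finrank_euclideanSpace_fin z
        have hW := (g t).weylNormSq_eq_curvNormSqWith hg finrank_euclideanSpace_fin z
        obtain ⟨hmz, hpz⟩ := hpinch t ht' z
        have hEnn := (g t).tracelessRicciNormSq_nonneg z
        have hWnn := (g t).weylNormSq_nonneg z
        rw [hR, hric, hscal, hcurv]
        refine ⟨hmz, ?_, ?_, ?_⟩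
        · rw [← hE]; exact hEnn
        · rw [← hW]; exact hWnn
        · rw [← hE, ← hW]; exact hpz
      have hE := (g t).tracelessRicciNormSq_eq_normSq hg finrank_euclideanSpace_fin z
      rw [← hric, ← hscal] at hE
      have hsplit : K * R ^ (2 - τ) = K * R ^ (-τ) * R ^ 2 := by
        rw [sub_eq_add_neg, Real.rpow_add hR0, Real.rpow_two]; ring
      rw [hE]
      nlinarith [mul_le_mul_of_nonneg_right hKR (sq_nonneg R)]
    have hsqrt : Real.sqrt ((g t).tracelessRicciNormSq z) ≤ R / 6 :=
      (Real.sqrt_le_left (by positivity)).2 hEsq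
    have hww : 0 ≤ (g t).val z w w := by
      by_cases hw : w = 0
      · simp [hw]
      · exact (hg z w hw).le
    have key := ricci_ge_of_tracelessRicciNormSq (g t) hg finrank_euclideanSpace_fin z w
    rw [← hscal] at key
    have hcoef : ((Module.finrank ℝ (EuclideanSpace ℝ (Fin 4)) : ℝ) - 1) * k ≤
        R / 4 - Real.sqrt ((g t).tracelessRicciNormSq z) := by
      rw [finrank_euclideanSpace_fin, hk]
      have h12 : (1 : ℝ) / (12 * h) ≤ R / 12 := by
        rw [div_le_div_iff₀ (by positivity) (by norm_num)]
        nlinarith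
      have : ((4 : ℕ) : ℝ) - 1 = 3 := by norm_num
      rw [this, show (3 : ℝ) * (1 / (36 * h)) = 1 / (12 * h) by field_simp; ring]
      linarith
    exact (mul_le_mul_of_nonneg_right hcoef hww).trans key
  -- Myers + the gradient bound
  have hosc := abs_sub_mul_sqrt_le_of_mfderiv_le (g t) hg
    (by rw [finrank_euclideanSpace_fin]; norm_num) hfd hA0 hAf hk0 hRic y x
  -- `√k = 1/(6√h)` and the power count `h √h √(h^{δ₁-3}) = h^{δ₁/2}`
  have hsh : 0 < Real.sqrt h := Real.sqrt_pos.2 hh0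
  have hsk : Real.sqrt k = (6 * Real.sqrt h)⁻¹ := by
    rw [hk, one_div, Real.sqrt_inv, Real.sqrt_mul (by norm_num), show (36 : ℝ) = 6 ^ 2 by norm_num,
      Real.sqrt_sq (by norm_num)]
  have hpow : h * Real.sqrt h * Real.sqrt (h ^ (δ₁ - 3)) = h ^ (δ₁ / 2) := by
    have e1 : Real.sqrt h = h ^ (1 / 2 : ℝ) := Real.sqrt_eq_rpow h
    have e2 : Real.sqrt (h ^ (δ₁ - 3)) = h ^ ((δ₁ - 3) * (1 / 2)) := by
      rw [Real.sqrt_eq_rpow, ← Real.rpow_mul hh0.le]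
    calc h * Real.sqrt h * Real.sqrt (h ^ (δ₁ - 3))
        = h ^ (1 : ℝ) * h ^ (1 / 2 : ℝ) * h ^ ((δ₁ - 3) * (1 / 2)) := by rw [Real.rpow_one, e1, e2]
      _ = h ^ (1 + 1 / 2 + (δ₁ - 3) * (1 / 2)) := by rw [Real.rpow_add hh0, Real.rpow_add hh0]
      _ = h ^ (δ₁ / 2) := by rw [show (1 + 1 / 2 + (δ₁ - 3) * (1 / 2) : ℝ) = δ₁ / 2 by ring]
  rw [hsk, ← div_eq_mul_inv, div_le_iff₀ (by positivity)] at hosc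
  calc h * |f x - f y| ≤ h * (A * Real.pi * (6 * Real.sqrt h)) :=
        mul_le_mul_of_nonneg_left hosc hh0.le
    _ = 6 * Real.pi * Real.sqrt C₁' * (h * Real.sqrt h * Real.sqrt (h ^ (δ₁ - 3))) := by
        rw [hA]; ring
    _ = 6 * Real.pi * Real.sqrt C₁' * h ^ (δ₁ / 2) := by rw [hpow]

end Literature.Geometry.Riemannian.HamiltonPinchedFlow

end Part4

/-!
## Part 5 — port of `Summits/SmoothPoincare4/SmoothPoincare4/Theorems/EntropyRungChangGurskyYangStubRoundnessRate.lean` (1 declarations kept)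

# Type-I bounds and the roundness rate of a pinched maximal Ricci flow (Hamilton 1982, §16 and §17, Lemma 17.2, Cor. 17.3, Cor. 17.5)

Declarations of this Part (verbatim port; each keeps its own docstring and citation): `stub_roundnessRate`.

References: R. S. Hamilton, *Three-manifolds with positive Ricci curvature*, J. Differential Geom. 17 (1982) 255–306 [Hamilton1982]; R. S. Hamilton, *Four-manifolds with positive curvature operator*, J. Differential Geom. 24 (1986) 153–179 [Hamilton1986]; G. Huisken, *Ricci deformation of the metric on a Riemannian manifold*, J. Differential Geom. 21 (1985) 47–62 [Huisken1985].
-/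

section Part5

open _root_.Set _root_.Function _root_.Filter
open scoped _root_.Manifold _root_.ContDiff _root_.Topology

namespace Literature.Geometry.Riemannian.HamiltonPinchedFlow

open Literature.Geometry.Riemannian
open Literature.Geometry.Lorentzian Literature.Geometry.Lorentzian.PseudoRiemannianMetric

/-- **TYPE-I BOUNDS AND THE ROUNDNESS RATE (Hamilton 1982, §16 with Lemma 17.2/Cor. 17.3/17.5,
in unnormalised clothes).** For the maximal pinched flow with `R_max/R_min → 1` (`stub_curvatureRatio`) and the
decay estimate (ii) of `stub_gradientEstimates`: at late times `|(T−t)R − 2| ≤ C(T−t)^δ`, `(T−t)²|E|² ≤ C(T−t)^{2δ}`,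
`(T−t)²|W|² ≤ C(T−t)^δ` and `|Rm|² ≤ C(T−t)^{−2}`. Proof: the Type-I sandwich `1 ≤ (T−t)R ≤ 3`,
`K R^{−τ} ≤ 1/20`, `R_min(T−t) ≤ 2` and `R_max(T−t) ≥ 1/a` whenever `2|Ric|² ≤ aR²` on `[t, T)`
(`helper_roundnessTypeOne`); the decay hypothesis with `c₁ = 1`, `c₂ = 3` and the oscillation bound
`(T−t)(R_max − R_min) ≤ C₂(T−t)^{δ₁/2}` (`helper_roundnessOscillation`); then with `h = T − t ≤ 1`,
`R^{−τ} ≤ h^τ`: `2|Ric|² ≤ (1/2 + Kh^τ)R²` on `[t, T)` gives `hR_max ≥ 2 − 4Kh^τ`, so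
`2 − 4Kh^τ − C₂h^{δ₁/2} ≤ hR ≤ 2 + C₂h^{δ₁/2}`; `h²·2|E|² ≤ h²KR^{2−τ} ≤ 9Kh^τ`, `h²|W|² ≤ 9Kh^τ`,
`h²|Rm|² ≤ 9Kh^τ + 3/2`; finally `δ = min(τ/2, δ₁/2)`, `C = 13K + C₂ + 3/2`.
[cite: Hamilton1982, §16, Lemmas 16.1–16.5; §17, Lemma 17.2, Cor. 17.3, Cor. 17.5] [cite: Huisken1985, §5] -/
theorem stub_roundnessRate :
    ∀ (M : Type) [TopologicalSpace M] [T2Space M] [SecondCountableTopology M]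
      [ChartedSpace (EuclideanSpace ℝ (Fin 4)) M] [IsManifold (𝓡 4) ∞ M] [CompactSpace M]
      [ConnectedSpace M]
      (g : ℝ → PseudoRiemannianMetric (𝓡 4) ∞ (EuclideanSpace ℝ (Fin 4)) (TangentSpace (𝓡 4) : M → Type _))
      (cov : ℝ → CovariantDerivative (𝓡 4) (EuclideanSpace ℝ (Fin 4)) (TangentSpace (𝓡 4) : M → Type _))
      (T m K τ : ℝ), 0 < m → 0 < K → 0 < τ → τ ≤ 1 →
      IsMaximalRicciFlow g cov T →
      (∀ t ∈ Ico 0 T, ∀ [(g t).HasLeviCivita] (x : M),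
        m ≤ (g t).scalarCurvature x ∧
          (g t).weylNormSq x + 2 * (g t).tracelessRicciNormSq x ≤
            K * (g t).scalarCurvature x ^ (2 - τ)) →
      (∀ (t₁ c₁ c₂ : ℝ), t₁ ∈ Ico 0 T → 0 < c₁ →
        (∀ t ∈ Ico t₁ T, ∀ x : M, c₁ ≤ (T - t) * (g t).scalarCurvatureWith (cov t) x ∧
          (T - t) * (g t).scalarCurvatureWith (cov t) x ≤ c₂) →
        ∃ δ C : ℝ, 0 < δ ∧ ∀ t ∈ Ico t₁ T, ∀ x : M,
          (g t).gradSq (fun y ↦ (g t).scalarCurvatureWith (cov t) y) x ≤ C * (T - t) ^ (δ - 3)) →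
      (∀ θ : ℝ, 0 < θ → θ < 1 → ∃ t₀ ∈ Ico 0 T, ∀ t ∈ Ico t₀ T, ∀ x y : M,
        θ * (g t).scalarCurvatureWith (cov t) y ≤ (g t).scalarCurvatureWith (cov t) x) →
      ∃ δ C t₀ : ℝ, 0 < δ ∧ 0 ≤ C ∧ t₀ ∈ Ico 0 T ∧ ∀ t ∈ Ico t₀ T, ∀ x : M,
        |(T - t) * (g t).scalarCurvatureWith (cov t) x - 2| ≤ C * (T - t) ^ δ ∧
        (T - t) ^ 2 * ((g t).normSq x ((cov t).ricci x) -
            (g t).scalarCurvatureWith (cov t) x ^ 2 / 4) ≤ C * (T - t) ^ (2 * δ) ∧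
        (T - t) ^ 2 * ((g t).curvNormSqWith (cov t) x - 2 * (g t).normSq x ((cov t).ricci x) +
            (g t).scalarCurvatureWith (cov t) x ^ 2 / 3) ≤ C * (T - t) ^ δ ∧
        (g t).curvNormSqWith (cov t) x ≤ C * ((T - t) ^ 2)⁻¹ := by
  intro M _ _ _ _ _ _ _ g cov T m K τ hm hK hτ0 hτ1 hmax hpinch hdecay hratio
  have hflow := hmax.isRicciFlow
  have hRiem := hmax.isRiemannian
  -- the Type-I sandwich, the gradient decay with `c₁ = 1`, `c₂ = 3`, the oscillation bound
  obtain ⟨t₁, ht₁, htype⟩ :=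
    helper_roundnessTypeOne M g cov T m K τ hm hK hτ0 hmax hpinch hratio
  obtain ⟨δ₁, C₁, hδ₁, hgrad⟩ := hdecay t₁ 1 3 ht₁ one_pos
    (fun t ht x ↦ ⟨((htype t ht).1 x).1, ((htype t ht).1 x).2.1⟩)
  have hosc := helper_roundnessOscillation M g cov T m K τ t₁ C₁ δ₁ hm hflow hRiem hpinch ht₁
    (fun t ht x ↦ ⟨((htype t ht).1 x).1, ((htype t ht).1 x).2.2⟩) hgrad
  clear hdecay hratio hgrad
  -- the constants
  set C₂ := 6 * Real.pi * Real.sqrt (max C₁ 0) with hC₂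
  have hC₂0 : 0 ≤ C₂ := by positivity
  refine ⟨min (τ / 2) (δ₁ / 2), 13 * K + C₂ + 3 / 2, max t₁ (T - 1), lt_min (by linarith) (by linarith),
    by positivity, ⟨le_max_of_le_left ht₁.1, max_lt ht₁.2 (by linarith)⟩, fun t ht x ↦ ?_⟩
  have hδτ : min (τ / 2) (δ₁ / 2) ≤ τ / 2 := min_le_left _ _
  have hδδ₁ : min (τ / 2) (δ₁ / 2) ≤ δ₁ / 2 := min_le_right _ _
  generalize min (τ / 2) (δ₁ / 2) = δ at hδτ hδδ₁ ⊢
  have ht₁t : t ∈ Ico t₁ T := ⟨(le_max_left _ _).trans ht.1, ht.2⟩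
  have ht' : t ∈ Ico 0 T := ⟨ht₁.1.trans ht₁t.1, ht.2⟩
  have hT1 : T - 1 ≤ t := (le_max_right _ _).trans ht.1
  have hh0 : 0 < T - t := sub_pos.2 ht.2
  obtain ⟨hall, hlow, ⟨x₁, hx₁⟩⟩ := htype t ht₁t
  -- `R^{-τ} ≤ (T - s)^τ ≤ (T - t)^τ` on `[t, T)`, from `(T - s) R ≥ 1`
  have hRτ : ∀ s ∈ Ico t T, ∀ y : M,
      (g s).scalarCurvatureWith (cov s) y ^ (-τ) ≤ (T - t) ^ τ := by
    intro s hs y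
    obtain ⟨h1, -, -⟩ := (htype s ⟨ht₁t.1.trans hs.1, hs.2⟩).1 y
    have hTs : 0 < T - s := sub_pos.2 hs.2
    have hinv : (T - s)⁻¹ ≤ (g s).scalarCurvatureWith (cov s) y := by
      rw [inv_le_iff_one_le_mul₀' hTs]; exact h1
    calc (g s).scalarCurvatureWith (cov s) y ^ (-τ) ≤ (T - s)⁻¹ ^ (-τ) :=
          Real.rpow_le_rpow_of_nonpos (inv_pos.2 hTs) hinv (by linarith)
      _ = (T - s) ^ τ := by rw [Real.inv_rpow hTs.le, Real.rpow_neg hTs.le, inv_inv]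
      _ ≤ (T - t) ^ τ := Real.rpow_le_rpow hTs.le (by linarith [hs.1]) hτ0.le
  -- the lower bound on `R_max(t)`: `2|Ric|² ≤ (1/2 + K (T-t)^τ) R²` on `[t, T)`
  have hRic : ∀ s ∈ Ico t T, ∀ y : M, 2 * (g s).normSq y ((cov s).ricci y) ≤
      (1 / 2 + K * (T - t) ^ τ) * (g s).scalarCurvatureWith (cov s) y ^ 2 := by
    intro s hs y
    obtain ⟨hmR', -, hWnn', hp'⟩ :=
      roundness_dictionary hflow hRiem hpinch ⟨ht'.1.trans hs.1, hs.2⟩ y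
    have hR0' : 0 < (g s).scalarCurvatureWith (cov s) y := hm.trans_le hmR'
    have hle : K * (g s).scalarCurvatureWith (cov s) y ^ (2 - τ) ≤
        K * (T - t) ^ τ * (g s).scalarCurvatureWith (cov s) y ^ 2 :=
      calc K * (g s).scalarCurvatureWith (cov s) y ^ (2 - τ)
          = K * (g s).scalarCurvatureWith (cov s) y ^ (-τ) *
              (g s).scalarCurvatureWith (cov s) y ^ 2 := by
            rw [sub_eq_add_neg, Real.rpow_add hR0', Real.rpow_two]; ring
        _ ≤ K * (T - t) ^ τ * (g s).scalarCurvatureWith (cov s) y ^ 2 :=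
            mul_le_mul_of_nonneg_right (mul_le_mul_of_nonneg_left (hRτ s hs y) hK.le)
              (sq_nonneg _)
    linarith
  obtain ⟨x₂, hx₂⟩ := hlow (1 / 2 + K * (T - t) ^ τ) (by positivity) hRic
  -- the facts at time `t`
  obtain ⟨h1R, h3R, -⟩ := hall x
  obtain ⟨h1x₂, -, -⟩ := hall x₂
  obtain ⟨hmR, hEnn, hWnn, hp⟩ := roundness_dictionary hflow hRiem hpinch ht' x
  have hRτx := hRτ t ⟨le_rfl, ht.2⟩ x
  have hosc₁ : (T - t) * |(g t).scalarCurvatureWith (cov t) x -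
      (g t).scalarCurvatureWith (cov t) x₁| ≤ C₂ * (T - t) ^ (δ₁ / 2) := hosc t ht₁t x x₁
  have hosc₂ : (T - t) * |(g t).scalarCurvatureWith (cov t) x₂ -
      (g t).scalarCurvatureWith (cov t) x| ≤ C₂ * (T - t) ^ (δ₁ / 2) := hosc t ht₁t x₂ x
  clear hRτ hRic hlow hall htype hosc hpinch hflow hRiem hmax
  rw [← abs_of_pos hh0, ← abs_mul, abs_of_pos hh0, mul_sub, abs_sub_le_iff] at hosc₁ hosc₂
  -- abbreviations
  set h := T - t with hh
  have hh1 : h ≤ 1 := by rw [hh]; linarith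
  set R := (g t).scalarCurvatureWith (cov t) x with hR
  set R₁ := (g t).scalarCurvatureWith (cov t) x₁ with hR₁
  set R₂ := (g t).scalarCurvatureWith (cov t) x₂ with hR₂
  set N := (g t).normSq x ((cov t).ricci x) with hN
  set Q := (g t).curvNormSqWith (cov t) x with hQ
  have hR0 : 0 < R := hm.trans_le hmR
  -- powers of `h ∈ (0, 1]`
  have hpow : ∀ a b : ℝ, b ≤ a → h ^ a ≤ h ^ b := fun a b hab ↦
    Real.rpow_le_rpow_of_exponent_ge hh0 hh1 hab
  have hhτ1 : h ^ τ ≤ 1 := Real.rpow_le_one hh0.le hh1 hτ0.le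
  have hhτ0 : 0 ≤ h ^ τ := Real.rpow_nonneg hh0.le _
  have hhδ : 0 ≤ h ^ δ := Real.rpow_nonneg hh0.le _
  have hh2δ : 0 ≤ h ^ (2 * δ) := Real.rpow_nonneg hh0.le _
  have hKδ : K * h ^ τ ≤ K * h ^ δ := mul_le_mul_of_nonneg_left (hpow _ _ (by linarith)) hK.le
  have hK2δ : K * h ^ τ ≤ K * h ^ (2 * δ) :=
    mul_le_mul_of_nonneg_left (hpow _ _ (by linarith)) hK.le
  have hC₂δ : C₂ * h ^ (δ₁ / 2) ≤ C₂ * h ^ δ := mul_le_mul_of_nonneg_left (hpow _ _ hδδ₁) hC₂0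
  have hKh1 : K * h ^ τ ≤ K := by simpa using mul_le_mul_of_nonneg_left hhτ1 hK.le
  have hKhδ : 0 ≤ K * h ^ δ := mul_nonneg hK.le hhδ
  have hKh2δ : 0 ≤ K * h ^ (2 * δ) := mul_nonneg hK.le hh2δ
  have hC₂hδ : 0 ≤ C₂ * h ^ δ := mul_nonneg hC₂0 hhδ
  have hC₂h2δ : 0 ≤ C₂ * h ^ (2 * δ) := mul_nonneg hC₂0 hh2δ
  have hh2 : 0 ≤ h ^ 2 := sq_nonneg h
  have hhR : (h * R) ^ 2 ≤ 9 := (pow_le_pow_left₀ (by linarith) h3R 2).trans (by norm_num)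
  -- `h² K R^{2-τ} ≤ 9 K h^τ`
  have hKR2 : h ^ 2 * (K * R ^ (2 - τ)) ≤ 9 * K * h ^ τ :=
    calc h ^ 2 * (K * R ^ (2 - τ)) = K * R ^ (-τ) * (h * R) ^ 2 := by
          rw [sub_eq_add_neg, Real.rpow_add hR0, Real.rpow_two]; ring
      _ ≤ K * h ^ τ * 9 :=
          mul_le_mul (mul_le_mul_of_nonneg_left hRτx hK.le) hhR (sq_nonneg _) (by positivity)
      _ = 9 * K * h ^ τ := by ring
  -- `h R_max ≥ 2 - 4 K h^τ`
  have hmax2 : 2 - 4 * (K * h ^ τ) ≤ h * R₂ := by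
    by_cases hX2 : h * R₂ ≤ 2
    · have := mul_le_mul_of_nonneg_left hX2 (mul_nonneg hK.le hhτ0)
      linarith
    · push Not at hX2
      linarith [mul_nonneg hK.le hhτ0]
  have hx₁' : h * R₁ ≤ 2 := hx₁
  refine ⟨?_, ?_, ?_, ?_⟩
  · -- `|hR - 2| ≤ C h^δ`
    rw [abs_sub_le_iff]
    constructor <;> linarith [hosc₁.1, hosc₂.1]
  · -- `h² |E|² ≤ C h^{2δ}`
    have hE2 : N - R ^ 2 / 4 ≤ K * R ^ (2 - τ) / 2 := by linarith
    have := mul_le_mul_of_nonneg_left hE2 hh2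
    linarith
  · -- `h² |W|² ≤ C h^δ`
    have hW2 : Q - 2 * N + R ^ 2 / 3 ≤ K * R ^ (2 - τ) := by linarith
    have := mul_le_mul_of_nonneg_left hW2 hh2
    linarith
  · -- `|Rm|² ≤ C h^{-2}`
    rw [← div_eq_mul_inv, le_div_iff₀ (pow_pos hh0 2)]
    have e : Q * h ^ 2 = h ^ 2 * ((Q - 2 * N + R ^ 2 / 3) + 2 * (N - R ^ 2 / 4)) +
        (h * R) ^ 2 / 6 := by ring
    rw [e]
    have := mul_le_mul_of_nonneg_left hp hh2
    linarith

end Literature.Geometry.Riemannian.HamiltonPinchedFlow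

end Part5

/-!
## Part 6 — port of `Summits/SmoothPoincare4/SmoothPoincare4/Theorems/EntropyRungChangGurskyYangStubScaledShi.lean` (3 declarations kept)

# Scaled Shi estimates for a Type-I Ricci flow near its final time (Topping 2006, §3.3)

Declarations of this Part (verbatim port; each keeps its own docstring and citation): `shi_constants_of_isRicciFlow`, `shi_window_bound_of_isRicciFlow`, `stub_scaledShi`.

References: P. Topping, *Lectures on the Ricci flow*, LMS Lecture Note Series 325, CUP 2006 [Topping2006]; R. S. Hamilton, *Three-manifolds with positive Ricci curvature*, J. Differential Geom. 17 (1982) 255–306 [Hamilton1982]; R. S. Hamilton, *Four-manifolds with positive curvature operator*, J. Differential Geom. 24 (1986) 153–179 [Hamilton1986].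
-/

section Part6

open _root_.Set _root_.Function _root_.Filter
open scoped _root_.Manifold _root_.ContDiff _root_.Topology

namespace Literature.Geometry.Riemannian.HamiltonPinchedFlow

open Literature.Geometry.Riemannian
open Literature.Geometry.Lorentzian Literature.Geometry.Lorentzian.PseudoRiemannianMetric

section General

variable {E : Type*} [NormedAddCommGroup E] [NormedSpace ℝ E] [FiniteDimensional ℝ E]
  [CompleteSpace E] {H : Type*} [TopologicalSpace H] {I : ModelWithCorners ℝ E H} [I.Boundaryless]
  {M : Type*} [TopologicalSpace M] [ChartedSpace H M] [IsManifold I ∞ M] [CompactSpace M]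
  {g : ℝ → PseudoRiemannianMetric I ∞ E (TangentSpace I : M → Type _)}
  {cov : ℝ → CovariantDerivative I E (TangentSpace I : M → Type _)} {T : ℝ}

/-- **The evolution inequalities (3.3.4) of all orders in the shape of the maximum-principle
half of Thm. 3.3.1**: along a Ricci flow of Riemannian metrics on `[0, T)`, `T > 0`, on a closed
manifold there is ONE sequence of constants `C_j ≥ 0` with
`∂ₜ U_j ≤ Δ U_j − 2 U_{j+1} + C_j Σ_{i ≤ j} √U_i √U_{j−i} √U_j` at every `t ∈ [0, T)`,
`U_j = curvDerivNormSq I g j` (the term `C √U_0 U_j` of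
`IsRicciFlow.derivWithin_curvDerivNormSq_le` is the `i = 0` summand, so it is absorbed by
doubling the constant). [cite: Topping2006, §3.3, (3.3.4)] -/
theorem shi_constants_of_isRicciFlow (hflow : IsRicciFlow g cov (Ico 0 T)) (hT : 0 < T)
    (hR : ∀ s ∈ Ico 0 T, (g s).IsRiemannian) :
    ∃ C : ℕ → ℝ, (∀ j, 0 ≤ C j) ∧ ∀ j, ∀ t ∈ Ico 0 T, ∀ z : M,
      derivWithin (fun s ↦ curvDerivNormSq I g j s z) (Ico 0 T) t ≤
        (g t).laplaceBeltrami (curvDerivNormSq I g j t) z - 2 * curvDerivNormSq I g (j + 1) t z +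
          C j * ∑ i ∈ Finset.range (j + 1), Real.sqrt (curvDerivNormSq I g i t z) *
            Real.sqrt (curvDerivNormSq I g (j - i) t z) *
              Real.sqrt (curvDerivNormSq I g j t z) := by
  have hS : UniqueDiffOn ℝ (Ico 0 T) := uniqueDiffOn_Ico 0 T
  have hS' := Ico_subset_closure_interior hT
  have h0 : (0 : ℝ) ∈ Ico 0 T := ⟨le_rfl, hT⟩
  choose C hC0 hC using fun j ↦ hflow.derivWithin_curvDerivNormSq_le hS hS' hR h0 j
  refine ⟨fun j ↦ 2 * C j, fun j ↦ mul_nonneg zero_le_two (hC0 j), fun j t ht z ↦ ?_⟩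
  have h := hC j t ht z
  -- abbreviations: `u i = U_i(t, z)`, `F i` the summands of the abstract shape
  set u : ℕ → ℝ := fun i ↦ curvDerivNormSq I g i t z with hu
  have hnn : ∀ i, 0 ≤ u i := fun i ↦ curvDerivNormSq_nonneg (hR t ht) i z
  set F : ℕ → ℝ := fun i ↦ Real.sqrt (u i) * Real.sqrt (u (j - i)) * Real.sqrt (u j) with hF
  have hFnn : ∀ i, 0 ≤ F i := fun i ↦
    mul_nonneg (mul_nonneg (Real.sqrt_nonneg _) (Real.sqrt_nonneg _)) (Real.sqrt_nonneg _)
  -- the sum of the abstract shape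
  have hsum : (∑ i ∈ Finset.range (j + 1), Real.sqrt (u i) * Real.sqrt (u (j - i)))
      * Real.sqrt (u j) = ∑ i ∈ Finset.range (j + 1), F i :=
    Finset.sum_mul _ _ _
  -- the extra term is the `i = 0` summand
  have hterm : Real.sqrt (u 0) * u j ≤ ∑ i ∈ Finset.range (j + 1), F i := by
    have h1 : Real.sqrt (u 0) * u j = F 0 := by
      rw [hF]
      dsimp only
      rw [Nat.sub_zero, mul_assoc, Real.mul_self_sqrt (hnn j)]
    rw [h1]
    exact Finset.single_le_sum (f := F) (fun i _ ↦ hFnn i) (Finset.mem_range.mpr (Nat.succ_pos j))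
  have e1 : C j * (∑ i ∈ Finset.range (j + 1), Real.sqrt (u i) * Real.sqrt (u (j - i)))
      * Real.sqrt (u j) = C j * ∑ i ∈ Finset.range (j + 1), F i := by
    rw [mul_assoc, hsum]
  have e2 : C j * Real.sqrt (u 0) * u j ≤ C j * ∑ i ∈ Finset.range (j + 1), F i := by
    rw [mul_assoc]
    exact mul_le_mul_of_nonneg_left hterm (hC0 j)
  show derivWithin (fun s ↦ curvDerivNormSq I g j s z) (Ico 0 T) t ≤
    (g t).laplaceBeltrami (curvDerivNormSq I g j t) z - 2 * u (j + 1) +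
      2 * C j * ∑ i ∈ Finset.range (j + 1), F i
  have h' : derivWithin (fun s ↦ curvDerivNormSq I g j s z) (Ico 0 T) t ≤
      (g t).laplaceBeltrami (curvDerivNormSq I g j t) z - 2 * u (j + 1) +
        C j * (∑ i ∈ Finset.range (j + 1), Real.sqrt (u i) * Real.sqrt (u (j - i)))
          * Real.sqrt (u j) + C j * Real.sqrt (u 0) * u j := h
  linarith only [h', e1, e2]

/-- **Thm. 3.3.1 (maximum-principle half) on a window `[a, b] ⊆ [0, T)` of a Ricci flow**: with
the constants `C` of `shi_constants_of_isRicciFlow`, if `U_0 ≤ M₀²` on `M × [a, b]` and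
`M₀ (b − a) ≤ 1` then `(b − a)^k U_k(b, ·) ≤ shiConst C k · M₀²` (`shi_maxPrinciple_bound_Icc`;
the time derivative within `[a, b]` is the one within `[0, T)`, `derivWithin_subset`).
[cite: Topping2006, Thm. 3.3.1] -/
theorem shi_window_bound_of_isRicciFlow (hflow : IsRicciFlow g cov (Ico 0 T)) (hT : 0 < T)
    (hR : ∀ s ∈ Ico 0 T, (g s).IsRiemannian) {C : ℕ → ℝ} (hC0 : ∀ j, 0 ≤ C j)
    (hC : ∀ j, ∀ t ∈ Ico 0 T, ∀ z : M,
      derivWithin (fun s ↦ curvDerivNormSq I g j s z) (Ico 0 T) t ≤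
        (g t).laplaceBeltrami (curvDerivNormSq I g j t) z - 2 * curvDerivNormSq I g (j + 1) t z +
          C j * ∑ i ∈ Finset.range (j + 1), Real.sqrt (curvDerivNormSq I g i t z) *
            Real.sqrt (curvDerivNormSq I g (j - i) t z) * Real.sqrt (curvDerivNormSq I g j t z))
    {a b M₀ : ℝ} (hab : a < b) (hsub : Icc a b ⊆ Ico 0 T) (hM₀ : 0 < M₀)
    (hτM : M₀ * (b - a) ≤ 1) (h0 : ∀ s ∈ Icc a b, ∀ x : M, curvDerivNormSq I g 0 s x ≤ M₀ ^ 2)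
    (k : ℕ) (x : M) :
    (b - a) ^ k * curvDerivNormSq I g k b x ≤ shiConst C k * M₀ ^ 2 := by
  have hS : UniqueDiffOn ℝ (Ico 0 T) := uniqueDiffOn_Ico 0 T
  have hS' := Ico_subset_closure_interior hT
  have hf : ∀ j, ContMDiffOn (I.prod 𝓘(ℝ, ℝ)) 𝓘(ℝ, ℝ) ∞
      (fun p : M × ℝ ↦ curvDerivNormSq I g j p.2 p.1) (univ ×ˢ Icc a b) := fun j ↦
    (hflow.contMDiffOn_curvDerivNormSq hS hS' hR j).mono (prod_mono Subset.rfl hsub)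
  have hev : ∀ j, ∀ s ∈ Icc a b, ∀ y : M,
      derivWithin (fun r ↦ curvDerivNormSq I g j r y) (Icc a b) s ≤
        (g s).laplaceBeltrami (curvDerivNormSq I g j s) y - 2 * curvDerivNormSq I g (j + 1) s y +
          C j * ∑ i ∈ Finset.range (j + 1), Real.sqrt (curvDerivNormSq I g i s y) *
            Real.sqrt (curvDerivNormSq I g (j - i) s y) *
              Real.sqrt (curvDerivNormSq I g j s y) := by
    intro j s hs y
    have hsT : s ∈ Ico 0 T := hsub hs
    have hdiff : DifferentiableWithinAt ℝ (fun r ↦ curvDerivNormSq I g j r y) (Ico 0 T) s :=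
      (hflow.hasDerivWithinAt_curvDerivNormSq hS hS' hR j y hsT).differentiableWithinAt
    rw [derivWithin_subset hsub (uniqueDiffOn_Icc hab s hs) hdiff]
    exact hC j s hsT y
  exact shi_maxPrinciple_bound_Icc (g := g) (f := fun j s y ↦ curvDerivNormSq I g j s y) hab
    (fun s hs ↦ hR s (hsub hs)) hf (fun j s hs y ↦ curvDerivNormSq_nonneg (hR s (hsub hs)) j y)
    hM₀ hτM h0 hC0 hev k b ⟨hab.le, le_rfl⟩ x

end General

/-- **SCALED SHI ESTIMATES FOR ONE TYPE-I FLOW (Topping 2006, Thm. 3.3.1; Hamilton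
1982, §13, Thm. 13.4 and §14, Lemma 14.4).** Along a Ricci flow of Riemannian metrics on `[0, T)`,
`T > 0`, on a closed 4-manifold with `|Rm|² ≤ C₀ (T − t)⁻²` on `[t₀, T)`, for every `k` there are
`C` and `t₁ ∈ [0, T)` with `|∇ᵏRm|² ≤ C (T − t)^{−k−2}` on `M × [t₁, T)`: the maximum-principle
half of Thm. 3.3.1 (`shi_window_bound_of_isRicciFlow`) on the shrinking windows
`[t − (T − t)/C₁, t] ⊆ [t₀, T)`, `C₁ = max C₀ 1`, `t ≥ t₁ = (T + t₀)/2`, with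
`M₀ = C₁/(T − t)` (`|Rm|² ≤ C₁ (T − s)⁻² ≤ C₁² (T − t)⁻²` on the window); output constant
`shiConst C k · C₁^{k+2}`. [cite: Topping2006, §3.3, Thm. 3.3.1]
[cite: Hamilton1982, §13, Thm. 13.4 and §14, Lemma 14.4] -/
theorem stub_scaledShi :
    ∀ (M : Type) [TopologicalSpace M] [T2Space M] [SecondCountableTopology M]
      [ChartedSpace (EuclideanSpace ℝ (Fin 4)) M] [IsManifold (𝓡 4) ∞ M] [CompactSpace M]
      (g : ℝ → PseudoRiemannianMetric (𝓡 4) ∞ (EuclideanSpace ℝ (Fin 4)) (TangentSpace (𝓡 4) : M → Type _))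
      (cov : ℝ → CovariantDerivative (𝓡 4) (EuclideanSpace ℝ (Fin 4)) (TangentSpace (𝓡 4) : M → Type _))
      (T : ℝ), 0 < T → IsRicciFlow g cov (Ico 0 T) → (∀ t ∈ Ico 0 T, (g t).IsRiemannian) →
      ∀ (C₀ t₀ : ℝ), t₀ ∈ Ico 0 T →
      (∀ t ∈ Ico t₀ T, ∀ x : M, (g t).curvNormSqWith (cov t) x ≤ C₀ * ((T - t) ^ 2)⁻¹) →
      ∀ k : ℕ, ∃ C t₁ : ℝ, t₁ ∈ Ico 0 T ∧ ∀ t ∈ Ico t₁ T, ∀ z : M,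
        curvDerivNormSq (𝓡 4) g k t z ≤ C * ((T - t) ^ (k + 2))⁻¹ := by
  intro M _ _ _ _ _ _ g cov T hT hflow hR C₀ t₀ ht₀ hbd k
  obtain ⟨C, hC0, hC⟩ := shi_constants_of_isRicciFlow hflow hT hR
  -- the constants
  set C₁ : ℝ := max C₀ 1 with hC₁
  have hC₁1 : 1 ≤ C₁ := le_max_right _ _
  have hC₁0 : 0 < C₁ := one_pos.trans_le hC₁1
  have hbd' : ∀ t ∈ Ico t₀ T, ∀ x : M, curvDerivNormSq (𝓡 4) g 0 t x ≤ C₁ * ((T - t) ^ 2)⁻¹ := by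
    intro t ht x
    have htT : t ∈ Ico 0 T := ⟨ht₀.1.trans ht.1, ht.2⟩
    rw [curvDerivNormSq_zero_eq (hR t htT) (hflow.isLeviCivita t htT)]
    exact (hbd t ht x).trans
      (mul_le_mul_of_nonneg_right (le_max_left _ _) (inv_nonneg.2 (sq_nonneg _)))
  refine ⟨shiConst C k * C₁ ^ (k + 2), (T + t₀) / 2, ⟨by linarith [ht₀.1], by linarith [ht₀.2]⟩,
    fun t ht z ↦ ?_⟩
  -- the window `[a, t]`, `a = t - (T - t)/C₁`
  have htT : t < T := ht.2
  have hTt : 0 < T - t := sub_pos.2 htT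
  have hτ0 : 0 < (T - t) / C₁ := div_pos hTt hC₁0
  have hτle : (T - t) / C₁ ≤ T - t := div_le_self hTt.le hC₁1
  have hat : t - (T - t) / C₁ < t := by linarith
  have ht₀a : t₀ ≤ t - (T - t) / C₁ := by
    have h₁ : (T + t₀) / 2 ≤ t := ht.1
    linarith
  have hsub : Icc (t - (T - t) / C₁) t ⊆ Ico 0 T := fun s hs ↦
    ⟨ht₀.1.trans (ht₀a.trans hs.1), hs.2.trans_lt htT⟩
  -- `M₀ = C₁ / (T - t)`
  have hM₀ : 0 < C₁ * (T - t)⁻¹ := mul_pos hC₁0 (inv_pos.2 hTt)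
  have hτM : C₁ * (T - t)⁻¹ * (t - (t - (T - t) / C₁)) ≤ 1 := by
    rw [sub_sub_cancel]
    field_simp
    rfl
  have h0 : ∀ s ∈ Icc (t - (T - t) / C₁) t, ∀ x : M,
      curvDerivNormSq (𝓡 4) g 0 s x ≤ (C₁ * (T - t)⁻¹) ^ 2 := by
    intro s hs x
    have hs' : s ∈ Ico t₀ T := ⟨ht₀a.trans hs.1, hs.2.trans_lt htT⟩
    refine (hbd' s hs' x).trans ?_
    have h₁ : ((T - s) ^ 2)⁻¹ ≤ ((T - t) ^ 2)⁻¹ :=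
      inv_anti₀ (pow_pos hTt 2) (pow_le_pow_left₀ hTt.le (by linarith [hs.2]) 2)
    have h₂ : C₁ ≤ C₁ ^ 2 := by nlinarith
    rw [mul_pow, inv_pow]
    exact mul_le_mul h₂ h₁ (inv_nonneg.2 (sq_nonneg _)) (sq_nonneg _)
  have hb := shi_window_bound_of_isRicciFlow hflow hT hR hC0 hC hat hsub hM₀ hτM h0 k z
  rw [sub_sub_cancel] at hb
  have hb' := (le_div_iff₀' (pow_pos hτ0 k)).2 hb
  refine hb'.trans (le_of_eq ?_)
  rw [div_pow, mul_pow, inv_pow, pow_add, pow_add]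
  field_simp

end Literature.Geometry.Riemannian.HamiltonPinchedFlow

end Part6

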